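import Literature.Analysis.FluidPDE.SelfSimilarLiouvilleSwirlDecayProofs
import Literature.Analysis.FluidPDE.AxisymmetricTypeIOffAxis
import HarnessLib

/-!
# Lei–Zhang–Zhao 2017, Theorem 1.3: the swirl in `L^∞_t L^p_x` (discharge)

Analysis/FluidPDE proof file (everything proved; no definitions, no named facts), sibling of
`SelfSimilarLiouville.lean` and of `SelfSimilarLiouvilleSwirlDecayProofs.lean`, discharging the
named fact `Literature.Analysis.FluidPDE.leiZhangZhao2017_liouville_swirl_Lp` recorded in
`SelfSimilarLiouville.lean`:

* `leiZhangZhao2017_liouville_swirl_Lp_holds : leiZhangZhao2017_liouville_swirl_Lp` (2026-08-21: kept here as a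
  kernel-checked `example` — the theorem of record with this name and statement is the one landed in
  `LeiZhangZhao2017LiouvilleSwirlLp.lean`; see the buildfix note before `SelfSimilar`) — every bounded
  ancient mild solution of Navier–Stokes (`ν = 1`) on `ℝ³ × (−∞, 0)` in the tree's duality form,
  with measurable and (pointwise) axisymmetric slices, whose swirl `Γ = x₀u₁ − x₁u₀ = r u_θ`
  satisfies `sup_{t<0} ‖Γ(t, ·)‖_{L^p(ℝ³)} ≤ K` for some `1 ≤ p < ∞`, is on every slice `t < 0`
  a.e. equal to an axial constant `β e_z`.

Source: Z. Lei, Q. S. Zhang, N. Zhao, *Improved Liouville theorems for axially symmetric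
Navier–Stokes equations*, arXiv:1701.00868 = Sci. Sin. Math. 47 (2017), **Theorem 1.3** (arXiv
p. 4: "Let `v` be a bounded ancient mild solution of the 3D axially symmetric Navier–Stokes
equations with `v_θ ≠ 0` and let `Γ = r v_θ`. If `Γ ∈ L^∞_t L^p_x(ℝ³ × (−∞, 0))` where
`1 ≤ p < ∞`, then `v` must be a constant"), proved in §5 (pp. 10–12) as Lemma 5.1 + Lemma 5.2.

## The printed proof and how it is followed

§5 (arXiv pp. 10–12): **Lemma 5.1** — under the hypotheses, `lim_{r→∞} Γ(x, t) = 0` uniformly in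
`t` and `z`; printed proof: *Step 1*, a Nash–Moser iteration for
`∂ₜΓ + b·∇Γ + (2/r)∂ᵣΓ − ΔΓ = 0` giving the mean value inequality
`sup_{Q_{1/2}(x₀,t₀)} |Γ| ≤ C (∫_{Q_1(x₀,t₀)} |Γ|^p)^{1/p}` for `r(x₀)` large; *Step 2*, "we can place
at least `[|x'₀|]` disjoint balls `B_1(x_i)` on the curve `S = {|x'| = |x'₀|, x₃ = x₀₃}`", and by the
axisymmetry of `Γ` each carries the same `L^p` mass, so
`[|x'₀|] ∫_{B_1(x₀)} |Γ(·,t)|^p ≤ ‖Γ(t)‖_p^p` and `|Γ(x₀, t₀)| ≤ C r^{-1/p}`. **Lemma 5.2** — then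
`Γ ≡ 0` (maximum principle and a contradiction argument) and KNSS 2009, Theorem 5.2 makes `v`
constant.

Lemma 5.2, its transport to KNSS's class of bounded weak solutions and to the tree's duality-form
class, and the final appeal to KNSS's Theorem 5.2 are already theorems of the tree
(`swirlDecay_eq_zero`, `leiZhangZhao2017_ae_swirl_free`, `leiZhangZhao2017_liouville_swirl_decay_holds`,
file `SelfSimilarLiouvilleSwirlDecayProofs`); this file repeats the last two with the `L^p`
hypothesis in place of the decay hypothesis (`leiZhangZhao2017_Lp_ae_swirl_free`,
`leiZhangZhao2017_liouville_swirl_Lp_holds`, the bridge steps copied verbatim) and **proves the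
conclusion of Lemma 5.1** for the smooth representative (`swirlLp_radial_decay`, with the
boundedness of `Γ` that print reads off the mean value inequality, `swirlLp_bounded`).

*Deviation (one step).* The Nash–Moser mean value inequality of Step 1 (De Giorgi energy estimate,
Sobolev embedding, Moser iteration) is neither in Mathlib nor in the tree. Its rôle in the proof —
a pointwise large value of `Γ` forces `L^p` mass of order one on a unit ball around the point — is
played here by the *stability form of the strong maximum principle*, KNSS 2009, Lemma 2.1
(`KNSS2009_lemma21`, a theorem of the tree: `KNSS2009_lemma21_holds`), exactly the tool by which
the tree proves Lemma 5.2: on a unit ball at distance `≥ 1` from the axis the drift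
`b + (2/r)e_r` of the swirl equation is bounded by `‖b‖_∞ + 2`, uniformly in the position of the
ball, so (`swirlLp_far`) a value `Γ(x₀, t₀) ≥ (1 − δ)M` at the centre of a ball on which `|Γ| ≤ M`
during the preceding unit of time spreads to `Γ ≥ M/2` on `B_{1/2}(x₀) × (t₀ − 1/2, t₀)`; Step 2
of the printed proof (the `⌈2r(x₀)⌉` disjoint rotated copies of `B_{1/2}(x₀)`, file
`AxisymmetricTypeIOffAxis`: `two_mul_le_dist_rotZ_of_lt`) then gives
`2 r(x₀) (M/2)^p |B_{1/2}| ≤ ‖Γ(t)‖_p^p ≤ K^p` (`lintegral_ge_packing_of_isAxisymmetricScalar`), i.e.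
*near-maxima of relative size `1 − δ` do not occur beyond the radius `R(M) = K^p/(2|B_{1/2}|(M/2)^p) + 2`*.
Two elementary arguments on suprema convert this into the two printed consequences of Step 1:
(a) `Γ` is bounded (`swirlLp_bounded`): the suprema `S(R)` of `|Γ|` over `{r ≤ R}` satisfy
`S(R) ≤ C_g R` and, whenever `S(R + 1) ≤ (1 + δ/2) S(R)`, `S(R) ≤ S_*` (a near-maximum of `S(R)` is
then a near-maximum of relative size `1 − δ` for the local bound `S(R + 1)`); if some `S(R₁) > S_*`
all `R₁ + n` would violate this, forcing geometric growth `S(R₁ + n) ≥ (1 + δ/2)ⁿ S(R₁)` against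
the linear bound; (b) `Γ → 0` uniformly (`swirlLp_radial_decay`): the suprema `D(R)` of `|Γ|` over
`{r ≥ R}` decrease to a limit `L`, and `L > 0` would produce, beyond any radius, a near-maximum of
relative size `1 − δ` for a local bound `< (1 + δ/2)L`. Everything else is as printed.

## Rendering choices

* The linear statements are for the scalar class of `swirlDecay_eq_zero` (smooth slices, `∇Γ`, `ΔΓ`
  jointly continuous, `|Γ| ≤ C_g r`, bounded jointly measurable drift, the swirl equation (5.10) of
  KNSS off the axis in time-integrated form), plus axisymmetry of `Γ(t, ·)` and the `L^p` bound
  `‖Γ(t, ·)‖_p ≤ K` for **a.e.** `t < 0` only (this is what the representation `u = U + β e_z`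
  a.e., for a.e. `t`, of KNSS's §4 regularity hands over; the bound is used at one time of a
  time interval of positive length). Any `0 < p < ∞` is allowed there; the fact has `1 ≤ p < ∞`.
* KNSS's Lemma 2.1 is applied to space–time translates `Γ(t₁ + s, x₀ + y)` by an arbitrary
  `x₀ ∈ ℝ³` (`swirlLp_translate_lemma21_data`; the tree's `swirlDecay_translate_lemma21_data`
  translates along the axis only), on the fixed configuration
  `Ω = B_1(0) ⊃ Ω' = B_{1/2}(0) ⊃ K = {0}`, `T = 1`, `τ = ε = 1/2`, so that `δ` does not depend
  on the position of the ball.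

## Mathlib / tree search

Used from the tree: `KNSS2009_lemma21(_holds)` (`KNSSSwirlLiouville`, `KNSSLemma21Proof`),
`swirlDecay_eq_zero` and the pattern of `swirlDecay_translate_lemma21_data`,
`leiZhangZhao2017_ae_swirl_free`, `leiZhangZhao2017_liouville_swirl_decay_holds`
(`SelfSimilarLiouvilleSwirlDecayProofs`), `two_mul_sq_le_pi_sq_mul_one_sub_cos`,
`two_mul_le_dist_rotZ_of_lt` (`AxisymmetricTypeIOffAxis`), `stPull`, `fderiv_stPull`,
`laplacian_stPull`, `uncurry_stPull`, `measurable_stAffine` (`SpaceTimeRescaling`), `norm_eR_le_one`,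
`measurable_eR`, `laplacian_add_const` (`KNSSSwirlTransport`), `SereginSverak2009.cylRadius_le_norm'`,
`SereginSverak2009.cylRadius_le_cylRadius_add` (`SereginSverakBlowupSelection`),
`cylRadius_le_cylRadius_add_norm_sub` (`AncientMildWeakStar`), the swirl calculus
(`SwirlTransportProofs`), `abs_swirl_le_cylRadius_mul_norm_add_smul_eZ`,
`continuousOn_iteratedFDeriv_of_lipschitz` (`KNSSSwirlLiouville`), the bridge lemmas of
`AncientMildModification`, `AncientMildDrift`, `KNSSThm52SliceBridge`, and the discharges
`KNSS2009_regularity_axisymmetric_swirl_holds`, `KNSS2009_liouville_axisymmetric_no_swirl_holds`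
(`KNSSThm53OfWindow`); from Mathlib: `Measure.addHaar_ball_center`, `lintegral_biUnion_finset`,
`lintegral_rpow_enorm_eq_rpow_eLpNorm'`, `eLpNorm_congr_ae`, `eLpNorm_neg`,
`tendsto_pow_const_div_const_pow_of_one_lt`, `closure_ball`, `Convex.isPreconnected`.
`lean search 'leiZhangZhao2017_liouville_swirl_Lp|swirlLp|Moser|meanValue'`: nothing prior besides the
fact and its sanity implications in `SelfSimilarLiouville`; no Moser iteration / parabolic mean
value inequality in Mathlib or the tree.

## References

* Z. Lei, Q. S. Zhang, N. Zhao, *Improved Liouville theorems for axially symmetric Navier–Stokes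
  equations*, arXiv:1701.00868 = Sci. Sin. Math. 47 (2017), doi:10.1360/N012016-00149: Theorem
  1.3 and Remark 1.4 (arXiv p. 4); §5, Lemma 5.1 with its proof, Steps 1–2, displays
  (meanvalue), (unidecay), (decay) (pp. 10–11), Lemma 5.2 (pp. 11–12). [LeiZhangZhao2017]
* G. Koch, N. Nadirashvili, G. Seregin, V. Šverák, *Liouville theorems for the Navier–Stokes
  equations and applications*, Acta Math. 203 (2009) 83–105 = arXiv:0709.3599: Lemma 2.1 (p. 5),
  §4 (p. 8), Theorem 5.2 (pp. 9–10), (5.10) (p. 10). [KochNadirashviliSereginSverak2009]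
-/

noncomputable section

open MeasureTheory Set Function Filter Topology TopologicalSpace InnerProductSpace Metric
open scoped RealInnerProductSpace NNReal ENNReal ContDiff Laplacian

namespace Literature.Analysis.FluidPDE

/-! ### Small measure-theoretic and geometric helpers -/

/-- A property holding for a.e. `t < 0` holds at some point of every interval `(a, b)`, `b ≤ 0`, of
positive length (intervals have positive Lebesgue measure). [folklore] -/
theorem exists_mem_Ioo_of_ae_restrict_Iio {P : ℝ → Prop}
    (h : ∀ᵐ t ∂((volume : Measure ℝ).restrict (Iio 0)), P t) {a b : ℝ} (hab : a < b) (hb : b ≤ 0) :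
    ∃ t ∈ Ioo a b, P t := by
  by_contra hne
  push Not at hne
  have h0 : ((volume : Measure ℝ).restrict (Iio 0)) {t | ¬P t} = 0 := ae_iff.1 h
  have hsub : Ioo a b ⊆ {t | ¬P t} := fun t ht => hne t ht
  have h1 : ((volume : Measure ℝ).restrict (Iio 0)) (Ioo a b) = 0 := measure_mono_null hsub h0
  have h2 : Ioo a b ∩ Iio (0 : ℝ) = Ioo a b :=
    inter_eq_left.2 fun t (ht : t ∈ Ioo a b) => show t < 0 from lt_of_lt_of_le ht.2 hb
  rw [Measure.restrict_apply measurableSet_Ioo, h2, Real.volume_Ioo] at h1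
  have : (0 : ℝ) < b - a := by linarith
  exact absurd h1 (ENNReal.ofReal_pos.2 this).ne'

/-- Rotations about the axis are isometries: `y ∈ B(R_θ x₀, ρ) ⟹ R_{−θ} y ∈ B(x₀, ρ)`. [folklore] -/
theorem mem_ball_rotZ_neg_of_mem_ball_rotZ {θ ρ : ℝ} {x₀ y : EuclideanSpace ℝ (Fin 3)}
    (hy : y ∈ ball (rotZ θ x₀) ρ) : rotZ (-θ) y ∈ ball x₀ ρ := by
  have hsub : ∀ (φ : ℝ) (a b : EuclideanSpace ℝ (Fin 3)), rotZ φ (a - b) = rotZ φ a - rotZ φ b := by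
    intro φ a b
    ext i
    fin_cases i <;> simp <;> ring
  rw [mem_ball, dist_eq_norm] at hy ⊢
  have e : rotZ (-θ) y - x₀ = rotZ (-θ) (y - rotZ θ x₀) := by
    rw [hsub, ← rotZ_add, neg_add_cancel, rotZ_zero]
  rw [e, norm_rotZ]
  exact hy

/-- **Lei–Zhang–Zhao 2017, proof of Lemma 5.1, Step 2: disjoint balls on a circle about the axis**
(arXiv:1701.00868 p. 11: "Define a family of balls `B_1(x)` of radius `1`, centered at `x` where
`x ∈ S = {|x'| = |x'₀|, x₃ = x₀₃}`. When `|x'₀|` is sufficiently large, we can place at least `[|x'₀|]`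
disjoint balls `B_1(x_i)` on the curve `S` … Due to the axis-symmetry of `Γ`, we have
`∫_{B_1(x_i)} |Γ(·,t)|^p = ∫_{B_1(x₀)} |Γ(·,t)|^p`. Thus `[|x'₀|] ∫_{B_1(x₀)} |Γ|^p ≤ ∫_{ℝ³} |Γ|^p`"),
in the form used here: if an axisymmetric scalar `g` is `≥ m` on a ball `B(x₀, ρ)` with
`0 < ρ ≤ r(x₀)`, then `(r(x₀)/ρ) · m^q · |B_ρ| ≤ ∫ |g|^q` for every `q > 0` — the
`N = ⌈r(x₀)/ρ⌉` balls `B(R_{kδ} x₀, ρ)`, `δ = πρ/r(x₀)`, `k < N`, are pairwise disjoint (the packing of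
the tree's `two_mul_le_dist_rotZ_of_lt`, file `AxisymmetricTypeIOffAxis`) and `g ≥ m` on each of
them by rotation invariance. [cite: LeiZhangZhao2017, proof of Lemma 5.1, Step 2 (arXiv p. 11)] -/
theorem lintegral_ge_packing_of_isAxisymmetricScalar {g : EuclideanSpace ℝ (Fin 3) → ℝ}
    (hax : IsAxisymmetricScalar g) {x₀ : EuclideanSpace ℝ (Fin 3)} {ρ m : ℝ} (hρ : 0 < ρ)
    (hρle : ρ ≤ cylRadius x₀) (hg : ∀ y ∈ ball x₀ ρ, m ≤ g y) {q : ℝ} (hq : 0 < q) :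
    ENNReal.ofReal (cylRadius x₀ / ρ) *
        (ENNReal.ofReal m ^ q * volume (ball (0 : EuclideanSpace ℝ (Fin 3)) ρ)) ≤
      ∫⁻ y, ‖g y‖ₑ ^ q := by
  have hx₀ : 0 < cylRadius x₀ := hρ.trans_le hρle
  -- the number of balls
  set N : ℕ := ⌈cylRadius x₀ / ρ⌉₊ with hN
  have hq1 : 1 ≤ cylRadius x₀ / ρ := by rw [le_div_iff₀ hρ, one_mul]; exact hρle
  have hN1 : cylRadius x₀ / ρ ≤ N := Nat.le_ceil _
  have hNpos : (0 : ℝ) < N := lt_of_lt_of_le (by linarith) hN1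
  -- the angle step
  set δ : ℝ := Real.pi * ρ / cylRadius x₀ with hδ
  have hδ0 : 0 ≤ δ := by positivity
  have hδρ : δ * cylRadius x₀ = Real.pi * ρ := by rw [hδ]; field_simp
  have hδπ : δ ≤ Real.pi := by
    rw [hδ, div_le_iff₀ hx₀]
    nlinarith [Real.pi_pos]
  have hNδ : ((N : ℝ) - 1) * δ ≤ Real.pi := by
    have hN2 : (N : ℝ) < cylRadius x₀ / ρ + 1 := Nat.ceil_lt_add_one (by positivity)
    have h1 : (N : ℝ) - 1 ≤ cylRadius x₀ / ρ := by linarith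
    calc ((N : ℝ) - 1) * δ ≤ cylRadius x₀ / ρ * δ := mul_le_mul_of_nonneg_right h1 hδ0
      _ = Real.pi := by rw [hδ]; field_simp
  have hchord : 4 * ρ ^ 2 ≤ 2 * (1 - Real.cos δ) * cylRadius x₀ ^ 2 := by
    have h1 := two_mul_sq_le_pi_sq_mul_one_sub_cos hδ0 hδπ
    have h3 : Real.pi ^ 2 * (2 * ρ ^ 2) ≤ Real.pi ^ 2 * ((1 - Real.cos δ) * cylRadius x₀ ^ 2) := by
      have e : Real.pi ^ 2 * (2 * ρ ^ 2) = 2 * δ ^ 2 * cylRadius x₀ ^ 2 := by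
        rw [show 2 * δ ^ 2 * cylRadius x₀ ^ 2 = 2 * (δ * cylRadius x₀) ^ 2 by ring, hδρ]
        ring
      rw [e]
      nlinarith [mul_le_mul_of_nonneg_right h1 (sq_nonneg (cylRadius x₀))]
    have h4 := le_of_mul_le_mul_left h3 (by positivity)
    linarith
  -- the centres
  set c : Fin N → EuclideanSpace ℝ (Fin 3) := fun k => rotZ (((k : ℕ) : ℝ) * δ) x₀ with hc
  have hsep : ∀ j k : Fin N, j ≠ k → 2 * ρ ≤ dist (c j) (c k) := by
    intro j k hjk
    rcases lt_or_gt_of_ne (Fin.val_injective.ne hjk) with h | h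
    · exact two_mul_le_dist_rotZ_of_lt hδ0 hNδ hρ.le hchord h k.isLt
    · rw [dist_comm]
      exact two_mul_le_dist_rotZ_of_lt hδ0 hNδ hρ.le hchord h j.isLt
  -- disjoint balls: the sum of the integrals over the balls is at most the total integral
  have hd : Set.PairwiseDisjoint (↑(Finset.univ : Finset (Fin N))) (fun k => ball (c k) ρ) := by
    intro j _ k _ hjk
    exact ball_disjoint_ball (by linarith [hsep j k hjk])
  have hsum : ∑ k, ∫⁻ y in ball (c k) ρ, ‖g y‖ₑ ^ q ≤ ∫⁻ y, ‖g y‖ₑ ^ q := by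
    rw [← lintegral_biUnion_finset hd (fun k _ => measurableSet_ball)]
    exact setLIntegral_le_lintegral _ _
  -- each ball carries at least `m^q |B_ρ|`
  have hterm : ∀ k : Fin N,
      ENNReal.ofReal m ^ q * volume (ball (0 : EuclideanSpace ℝ (Fin 3)) ρ) ≤
        ∫⁻ y in ball (c k) ρ, ‖g y‖ₑ ^ q := by
    intro k
    rw [← Measure.addHaar_ball_center volume (c k) ρ, ← setLIntegral_const]
    refine setLIntegral_mono' measurableSet_ball fun y hy => ?_
    have hy' : rotZ (-(((k : ℕ) : ℝ) * δ)) y ∈ ball x₀ ρ := mem_ball_rotZ_neg_of_mem_ball_rotZ hy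
    have hgy : m ≤ g y := by
      have e : g y = g (rotZ (-(((k : ℕ) : ℝ) * δ)) y) := by
        conv_lhs => rw [show y = rotZ (((k : ℕ) : ℝ) * δ) (rotZ (-(((k : ℕ) : ℝ) * δ)) y) by
          rw [← rotZ_add, add_neg_cancel, rotZ_zero]]
        exact hax _ _
      rw [e]
      exact hg _ hy'
    refine ENNReal.rpow_le_rpow ?_ hq.le
    rw [Real.enorm_eq_ofReal_abs]
    exact ENNReal.ofReal_le_ofReal (hgy.trans (le_abs_self _))
  have hsum' : (N : ℝ≥0∞) * (ENNReal.ofReal m ^ q * volume (ball (0 : EuclideanSpace ℝ (Fin 3)) ρ)) ≤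
      ∑ k : Fin N, ∫⁻ y in ball (c k) ρ, ‖g y‖ₑ ^ q := by
    have h := Finset.sum_le_sum fun k (_ : k ∈ (Finset.univ : Finset (Fin N))) => hterm k
    simp only [Finset.sum_const, Finset.card_univ, Fintype.card_fin, nsmul_eq_mul] at h
    exact h
  have hNle : ENNReal.ofReal (cylRadius x₀ / ρ) ≤ (N : ℝ≥0∞) := by
    rw [← ENNReal.ofReal_natCast]
    exact ENNReal.ofReal_le_ofReal hN1
  calc ENNReal.ofReal (cylRadius x₀ / ρ) *
        (ENNReal.ofReal m ^ q * volume (ball (0 : EuclideanSpace ℝ (Fin 3)) ρ))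
      ≤ (N : ℝ≥0∞) * (ENNReal.ofReal m ^ q * volume (ball (0 : EuclideanSpace ℝ (Fin 3)) ρ)) := by
        gcongr
    _ ≤ ∑ k : Fin N, ∫⁻ y in ball (c k) ρ, ‖g y‖ₑ ^ q := hsum'
    _ ≤ ∫⁻ y, ‖g y‖ₑ ^ q := hsum

/-- **The hypotheses of KNSS's Lemma 2.1 for a space–time translate of the swirl equation with a
bounded drift, on a region whose translate stays away from the axis** — the variant of the tree's
`swirlDecay_translate_lemma21_data` (translations along the axis) for an arbitrary spatial
translation `x₀` (the equation is no longer axisymmetric about the new origin, but Lemma 2.1 only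
needs a bounded measurable drift): for `f`, `u` on `t < 0` with smooth slices, `∇f`, `Δf` jointly
continuous, `u` jointly measurable with `‖u‖ ≤ C_u`, and the swirl equation
`fₜ + u·∇f + (2/r)∂ᵣf = Δf` (KNSS 2009, (5.10); Lei–Zhang–Zhao 2017, (Gammaequ) p. 10) off the axis
in time-integrated form; for `t₁ + T < 0`, a constant `m` and `Ω` with `r(x₀ + y) > a > 0` for
`y ∈ Ω`: the translates `F(s, y) = f(t₁ + s, x₀ + y)`, `V(s, y) = u(t₁ + s, x₀ + y)` (the tree's
`stPull 1 1 t₁ x₀`) satisfy — the merged drift `V + (2/r)e_r ∘ (x₀ + ·)` is jointly measurable and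
bounded by `C_u + 2/a` on `(0, T] × Ω`, and `g = F + m` is in the elementary solution class of
`KNSS2009_lemma21` on `(0, T] × Ω` with that drift. [cite: KochNadirashviliSereginSverak2009, Lemma 2.1 (arXiv p. 5) and (5.10) (p. 10)] -/
theorem swirlLp_translate_lemma21_data {f : ℝ → (EuclideanSpace ℝ (Fin 3)) → ℝ}
    {u : ℝ → (EuclideanSpace ℝ (Fin 3)) → (EuclideanSpace ℝ (Fin 3))} {Cu : ℝ}
    (h1 : ∀ t < 0, ContDiff ℝ ∞ (f t))
    (h2 : ContinuousOn (fun p : ℝ × (EuclideanSpace ℝ (Fin 3)) => fderiv ℝ (f p.1) p.2) (Iio 0 ×ˢ univ))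
    (h3 : ContinuousOn (fun p : ℝ × (EuclideanSpace ℝ (Fin 3)) => (Δ (f p.1)) p.2) (Iio 0 ×ˢ univ))
    (h6 : Measurable (uncurry u))
    (h7 : ∀ t < 0, ∀ x, ‖u t x‖ ≤ Cu)
    (h8 : ∀ x, cylRadius x ≠ 0 → ∀ s t : ℝ, s ≤ t → t < 0 →
      f t x - f s x = ∫ τ in s..t, ((Δ (f τ)) x - fderiv ℝ (f τ) x (u τ x) -
        2 / cylRadius x * partialDeriv (eR x) (f τ) x))
    {t₁ T a : ℝ} (x₀ : EuclideanSpace ℝ (Fin 3)) (hT : t₁ + T < 0) (ha : 0 < a) (m : ℝ)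
    {Ω : Set (EuclideanSpace ℝ (Fin 3))} (hΩ : ∀ y ∈ Ω, a < cylRadius (x₀ + y)) :
    Measurable (uncurry fun s y =>
      stPull 1 1 t₁ x₀ u s y + (2 / cylRadius (x₀ + y)) • eR (x₀ + y)) ∧
    (∀ s ∈ Ioc 0 T, ∀ y ∈ Ω,
      ‖stPull 1 1 t₁ x₀ u s y + (2 / cylRadius (x₀ + y)) • eR (x₀ + y)‖ ≤ Cu + 2 / a) ∧
    (∀ s ∈ Ioc 0 T, ContDiffOn ℝ 2 (fun y => stPull 1 1 t₁ x₀ f s y + m) Ω) ∧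
    ContinuousOn (fun p : ℝ × (EuclideanSpace ℝ (Fin 3)) =>
      fderiv ℝ (fun y => stPull 1 1 t₁ x₀ f p.1 y + m) p.2) (Ioc 0 T ×ˢ Ω) ∧
    ContinuousOn (fun p : ℝ × (EuclideanSpace ℝ (Fin 3)) =>
      (Δ fun y => stPull 1 1 t₁ x₀ f p.1 y + m) p.2) (Ioc 0 T ×ˢ Ω) ∧
    (∀ y ∈ Ω, ∀ s t : ℝ, 0 < s → s ≤ t → t ≤ T →
      (stPull 1 1 t₁ x₀ f t y + m) - (stPull 1 1 t₁ x₀ f s y + m) =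
        ∫ r in s..t, ((Δ fun y => stPull 1 1 t₁ x₀ f r y + m) y -
          fderiv ℝ (fun y => stPull 1 1 t₁ x₀ f r y + m) y
            (stPull 1 1 t₁ x₀ u r y + (2 / cylRadius (x₀ + y)) • eR (x₀ + y)))) := by
  have hτ : ∀ s ∈ Ioc (0 : ℝ) T, t₁ + 1 * s < 0 := fun s hs => by linarith [hs.2]
  have hΦc : Continuous fun p : ℝ × (EuclideanSpace ℝ (Fin 3)) =>
      (t₁ + 1 * p.1, x₀ + (1 : ℝ) • p.2) := by fun_prop
  have hΦmaps : MapsTo (fun p : ℝ × (EuclideanSpace ℝ (Fin 3)) => (t₁ + 1 * p.1, x₀ + (1 : ℝ) • p.2))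
      (Ioc 0 T ×ˢ Ω) (Iio 0 ×ˢ univ) := fun p hp => ⟨hτ p.1 hp.1, mem_univ _⟩
  have hsub : ∀ p ∈ Ioc (0 : ℝ) T ×ˢ Ω, t₁ + 1 * p.1 < 0 := fun p hp => hτ p.1 hp.1
  have hX : ∀ y : (EuclideanSpace ℝ (Fin 3)), x₀ + (1 : ℝ) • y = x₀ + y := fun y => by
    rw [one_smul]
  have hslice2 : ∀ σ : ℝ, t₁ + 1 * σ < 0 → ContDiff ℝ 2 (stPull 1 1 t₁ x₀ f σ) := by
    intro σ hσ
    have hf : ContDiff ℝ 2 (f (t₁ + 1 * σ)) := (h1 _ hσ).of_le (by norm_cast)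
    exact hf.comp (contDiff_const.add (contDiff_const_smul (1 : ℝ)))
  refine ⟨?_, ?_, ?_, ?_, ?_, ?_⟩
  · -- measurability of the merged drift
    have hV : Measurable (uncurry (stPull 1 1 t₁ x₀ u)) := by
      rw [uncurry_stPull]
      exact h6.comp (measurable_stAffine _ _ _ _)
    have hsh : Continuous fun p : ℝ × (EuclideanSpace ℝ (Fin 3)) => x₀ + p.2 := by fun_prop
    have h1' : Measurable fun p : ℝ × (EuclideanSpace ℝ (Fin 3)) =>
        (2 / cylRadius (x₀ + p.2)) • eR (x₀ + p.2) :=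
      ((measurable_const.div continuous_cylRadius.measurable).comp hsh.measurable).smul
        (measurable_eR.comp hsh.measurable)
    exact hV.add h1'
  · -- the drift bound on `Ω`
    intro s hs y hy
    have hr := hΩ y hy
    have hr0 : 0 < cylRadius (x₀ + y) := ha.trans hr
    have hV : ‖stPull 1 1 t₁ x₀ u s y‖ ≤ Cu := by
      rw [stPull_apply]
      exact h7 _ (hτ s hs) _
    have hE : ‖(2 / cylRadius (x₀ + y)) • eR (x₀ + y)‖ ≤ 2 / a := by
      rw [norm_smul, Real.norm_eq_abs, abs_of_nonneg (by positivity)]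
      calc 2 / cylRadius (x₀ + y) * ‖eR (x₀ + y)‖ ≤ 2 / cylRadius (x₀ + y) * 1 := by
            gcongr
            exact norm_eR_le_one _
        _ ≤ 2 / a := by
            rw [mul_one]
            exact div_le_div_of_nonneg_left (by norm_num) ha hr.le
    exact (norm_add_le _ _).trans (add_le_add hV hE)
  · -- `C²` slices
    intro s hs
    exact ((hslice2 s (hτ s hs)).add contDiff_const).contDiffOn
  · -- `∇g = ∇F`, a translate of `∇f`
    have hc := h2.comp hΦc.continuousOn hΦmaps
    refine hc.congr fun p _ => ?_
    simp only [comp_apply]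
    rw [fderiv_add_const, fderiv_stPull, one_smul]
  · -- `Δg = ΔF`, a translate of `Δf`
    have hc := h3.comp hΦc.continuousOn hΦmaps
    refine hc.congr fun p hp => ?_
    have hf2 : ContDiff ℝ 2 (f (t₁ + 1 * p.1)) := (h1 _ (hsub p hp)).of_le (by norm_cast)
    simp only [comp_apply]
    rw [laplacian_add_const (hslice2 p.1 (hsub p hp)).contDiffAt m,
      laplacian_stPull 1 1 t₁ x₀ f p.1 p.2 hf2, one_pow, one_smul]
  · -- the equation with the merged drift: translate (5.10) and substitute `τ = t₁ + σ`
    intro y hy s t hs hst htT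
    have hr := hΩ y hy
    have hy0 : cylRadius (x₀ + y) ≠ 0 := (ha.trans hr).ne'
    have hyX : cylRadius (x₀ + (1 : ℝ) • y) ≠ 0 := by rw [hX]; exact hy0
    have ht0 : t₁ + 1 * t < 0 := by linarith
    set X : (EuclideanSpace ℝ (Fin 3)) := x₀ + (1 : ℝ) • y with hXdef
    set G : ℝ → ℝ := fun τ' => (Δ (f τ')) X - fderiv ℝ (f τ') X (u τ' X) -
      2 / cylRadius X * partialDeriv (eR X) (f τ') X with hG
    have hsrc : f (t₁ + 1 * t) X - f (t₁ + 1 * s) X = ∫ τ' in (t₁ + 1 * s)..(t₁ + 1 * t), G τ' :=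
      h8 X hyX (t₁ + 1 * s) (t₁ + 1 * t) (by linarith) ht0
    have hint : EqOn (fun σ => (Δ fun y => stPull 1 1 t₁ x₀ f σ y + m) y -
        fderiv ℝ (fun y => stPull 1 1 t₁ x₀ f σ y + m) y
          (stPull 1 1 t₁ x₀ u σ y + (2 / cylRadius (x₀ + y)) • eR (x₀ + y)))
        (fun σ => G (t₁ + 1 * σ)) (uIcc s t) := by
      intro σ hσ
      rw [uIcc_of_le hst] at hσ
      have hσ' : t₁ + 1 * σ < 0 := by linarith [hσ.2]
      have hf2 : ContDiff ℝ 2 (f (t₁ + 1 * σ)) := (h1 _ hσ').of_le (by norm_cast)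
      simp only [hG]
      rw [laplacian_add_const (hslice2 σ hσ').contDiffAt m, fderiv_add_const,
        laplacian_stPull 1 1 t₁ x₀ f σ y hf2, fderiv_stPull, stPull_apply,
        partialDeriv_apply]
      rw [← hXdef, ← hX y, ← hXdef]
      simp only [one_pow, one_smul, map_add, map_smul, smul_eq_mul]
      ring
    have hlhs : stPull 1 1 t₁ x₀ f t y + m - (stPull 1 1 t₁ x₀ f s y + m) =
        f (t₁ + 1 * t) X - f (t₁ + 1 * s) X := by
      simp only [stPull_apply]
      ring
    rw [hlhs, hsrc, intervalIntegral.integral_congr hint,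
      ← intervalIntegral.smul_integral_comp_add_mul G 1 t₁, one_smul]

/-! ### Lemma 5.1, the local step: no near-maximum far from the axis -/

/-- **Lei–Zhang–Zhao 2017, Lemma 5.1, the local step — no near-maximum far from the axis**
(arXiv:1701.00868 pp. 10–11; in print: the mean value inequality (meanvalue)
`sup_{Q_{1/2}(x₀,t₀)} |Γ| ≤ C (∫_{Q_1(x₀,t₀)} |Γ|^p)^{1/p}` of Step 1 combined with the ball count of
Step 2, `(∫_{Q_1(x₀,t₀)} |Γ|^p)^{1/p} ≤ C r^{−1/p}`). **Statement.** For a scalar `f` and a drift `u` as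
in `swirlDecay_eq_zero` (smooth slices, `∇f`, `Δf` jointly continuous, `u` jointly measurable with
`‖u‖ ≤ C_u`, the swirl equation off the axis in time-integrated form) with `f(t, ·)` axisymmetric
and `‖f(t, ·)‖_{L^p} ≤ K` for a.e. `t < 0` (`0 < p < ∞`): there is `δ ∈ (0, 1)` and, for every
`M₀ > 0`, a radius `R ≥ 2` such that for `M ≥ M₀`, `t₀ < 0` and `r(x₀) ≥ R`, if `|f| ≤ M` on
`B(x₀, 1) × (t₀ − 1, t₀]` then `f(t₀, x₀) < (1 − δ)M`. **Proof** (the deviation from print recorded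
in the module docstring): `δ` is the constant of KNSS's Lemma 2.1 (`KNSS2009_lemma21`) for
`Ω = B_1 ⊃ Ω' = B_{1/2} ⊃ K = {0}`, `T = 1`, `τ = ε = 1/2` and the drift bound `C_u + 2` (valid on
every unit ball at distance `≥ 1` from the axis, `swirlLp_translate_lemma21_data`); if
`f(t₀, x₀) ≥ (1 − δ)M`, Lemma 2.1 applied to the translate gives `f ≥ M/2` on
`B(x₀, 1/2) × (t₀ − 1/2, t₀)`, and at a time of this window where the `L^p` bound holds the
disjoint rotated half-balls of Step 2 (`lintegral_ge_packing_of_isAxisymmetricScalar`) give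
`2 r(x₀) (M/2)^p |B_{1/2}| ≤ K^p`, i.e. `r(x₀) ≤ K^p / (2 |B_{1/2}| (M₀/2)^p) < R`. [cite: LeiZhangZhao2017, Lemma 5.1 and its proof, Steps 1–2 (arXiv pp. 10–11); KochNadirashviliSereginSverak2009, Lemma 2.1 (arXiv p. 5)] -/
theorem swirlLp_far (hL21 : KNSS2009_lemma21 (EuclideanSpace ℝ (Fin 3)))
    {f : ℝ → (EuclideanSpace ℝ (Fin 3)) → ℝ} {u : ℝ → (EuclideanSpace ℝ (Fin 3)) → (EuclideanSpace ℝ (Fin 3))}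
    {Cu : ℝ}
    (h1 : ∀ t < 0, ContDiff ℝ ∞ (f t))
    (h2 : ContinuousOn (fun p : ℝ × (EuclideanSpace ℝ (Fin 3)) => fderiv ℝ (f p.1) p.2) (Iio 0 ×ˢ univ))
    (h3 : ContinuousOn (fun p : ℝ × (EuclideanSpace ℝ (Fin 3)) => (Δ (f p.1)) p.2) (Iio 0 ×ˢ univ))
    (hax : ∀ t < 0, IsAxisymmetricScalar (f t))
    (h6 : Measurable (uncurry u))
    (h7 : ∀ t < 0, ∀ x, ‖u t x‖ ≤ Cu)
    (h8 : ∀ x, cylRadius x ≠ 0 → ∀ s t : ℝ, s ≤ t → t < 0 →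
      f t x - f s x = ∫ τ in s..t, ((Δ (f τ)) x - fderiv ℝ (f τ) x (u τ x) -
        2 / cylRadius x * partialDeriv (eR x) (f τ) x))
    {p : ℝ≥0∞} {K : ℝ≥0} (hp0 : p ≠ 0) (hpt : p ≠ ⊤)
    (hLp : ∀ᵐ t ∂((volume : Measure ℝ).restrict (Iio 0)), eLpNorm (f t) p volume ≤ K) :
    ∃ δ : ℝ, 0 < δ ∧ δ < 1 ∧ ∀ M₀ : ℝ, 0 < M₀ → ∃ R : ℝ, 2 ≤ R ∧
      ∀ M : ℝ, M₀ ≤ M → ∀ t₀ < 0, ∀ x₀ : EuclideanSpace ℝ (Fin 3), R ≤ cylRadius x₀ →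
        (∀ t ∈ Ioc (t₀ - 1) t₀, ∀ y ∈ ball x₀ 1, |f t y| ≤ M) → f t₀ x₀ < M * (1 - δ) := by
  -- the configuration of Lemma 2.1: unit ball, half ball, centre
  set Ω : Set (EuclideanSpace ℝ (Fin 3)) := ball 0 1 with hΩ_def
  set Ω' : Set (EuclideanSpace ℝ (Fin 3)) := ball 0 (1 / 2) with hΩ'_def
  set K₀ : Set (EuclideanSpace ℝ (Fin 3)) := {0} with hK₀_def
  have hΩo : IsOpen Ω := isOpen_ball
  have hΩb : Bornology.IsBounded Ω := isBounded_ball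
  have hΩc : IsConnected Ω :=
    ⟨⟨0, mem_ball_self one_pos⟩, (convex_ball (0 : EuclideanSpace ℝ (Fin 3)) 1).isPreconnected⟩
  have hcl : closure Ω' ⊆ Ω := by
    rw [hΩ'_def, closure_ball (0 : EuclideanSpace ℝ (Fin 3)) (by norm_num : (1 / 2 : ℝ) ≠ 0)]
    exact closedBall_subset_ball (by norm_num)
  have hKc : IsCompact K₀ := isCompact_singleton
  have hKΩ : K₀ ⊆ Ω := singleton_subset_iff.2 (mem_ball_self one_pos)
  obtain ⟨δ, hδ, hP⟩ := hL21 (T := 1) (A := Cu + 2 / 1) hΩo hΩb hΩc hcl hKc hKΩ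
    (by norm_num : (0 : ℝ) < 1 / 2) (by norm_num : (0 : ℝ) < 1 / 2)
  set δ' : ℝ := min δ (1 / 2) with hδ'_def
  have hδ'0 : 0 < δ' := lt_min hδ (by norm_num)
  have hδ'1 : δ' < 1 := lt_of_le_of_lt (min_le_right _ _) (by norm_num)
  have hδ'δ : δ' ≤ δ := min_le_left _ _
  refine ⟨δ', hδ'0, hδ'1, fun M₀ hM₀ => ?_⟩
  -- the exponent and the volume of the half ball
  set q : ℝ := p.toReal with hq_def
  have hq : 0 < q := ENNReal.toReal_pos hp0 hpt
  set v : ℝ≥0∞ := volume (ball (0 : EuclideanSpace ℝ (Fin 3)) (1 / 2)) with hv_def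
  have hv0 : v ≠ 0 := (measure_ball_pos volume (0 : EuclideanSpace ℝ (Fin 3)) (by norm_num)).ne'
  have hvt : v ≠ ⊤ := measure_ball_lt_top.ne
  have hvr : 0 < v.toReal := ENNReal.toReal_pos hv0 hvt
  -- the radius beyond which near-maxima are impossible
  set R : ℝ := (K : ℝ) ^ q / (2 * v.toReal * (M₀ / 2) ^ q) + 2 with hR_def
  have hfrac : 0 ≤ (K : ℝ) ^ q / (2 * v.toReal * (M₀ / 2) ^ q) := by positivity
  refine ⟨R, by linarith, fun M hM t₀ ht₀ x₀ hx₀ hloc => ?_⟩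
  have hMpos : 0 < M := hM₀.trans_le hM
  have hr2 : 2 ≤ cylRadius x₀ := le_trans (by linarith) hx₀
  by_contra hge
  push Not at hge
  -- the translated pair on the unit ball around `x₀`, final time `t₀ ↔ s = 1`
  have hΩr : ∀ y ∈ Ω, 1 < cylRadius (x₀ + y) := by
    intro y hy
    rw [hΩ_def, mem_ball, dist_zero_right] at hy
    have h1' := SereginSverak2009.cylRadius_le_cylRadius_add x₀ (x₀ + y)
    have h2' : cylRadius (x₀ - (x₀ + y)) ≤ ‖y‖ := by
      rw [show x₀ - (x₀ + y) = -y by abel, ← neg_one_smul ℝ y, cylRadius_smul]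
      simpa using SereginSverak2009.cylRadius_le_norm' y
    linarith
  obtain ⟨hb_meas, hb_bd, hg_C2, hg_cont1, hg_cont2, hg_eq⟩ :=
    swirlLp_translate_lemma21_data h1 h2 h3 h6 h7 h8 x₀ (T := 1) (t₁ := t₀ - 1)
      (by linarith) one_pos 0 hΩr
  set F : ℝ → EuclideanSpace ℝ (Fin 3) → ℝ := stPull 1 1 (t₀ - 1) x₀ f with hF_def
  have hFval : ∀ s y, F s y = f (t₀ - 1 + s) (x₀ + y) := by
    intro s y
    simp only [hF_def, stPull_apply, one_mul, one_smul]
  -- `|F| ≤ M` on `(0, 1] × Ω`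
  have hg_bd : ∀ s ∈ Ioc (0 : ℝ) 1, ∀ y ∈ Ω, |F s y + 0| ≤ M := by
    intro s hs y hy
    rw [add_zero, hFval]
    refine hloc _ ⟨by linarith [hs.1], by linarith [hs.2]⟩ _ ?_
    rw [hΩ_def, mem_ball, dist_zero_right] at hy
    rwa [mem_ball, dist_eq_norm, add_sub_cancel_left]
  -- the near-maximum at `(1, 0)`
  have hnear : ∃ x ∈ K₀, M * (1 - δ) ≤ F 1 x + 0 := by
    refine ⟨0, rfl, ?_⟩
    rw [add_zero, hFval, add_zero, sub_add_cancel]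
    have : M * (1 - δ) ≤ M * (1 - δ') := by nlinarith
    exact this.trans hge
  have key := hP hb_meas hb_bd hg_C2 hg_cont1 hg_cont2 hg_eq hMpos hg_bd hnear
  -- the plateau: `f ≥ M/2` on `ball x₀ (1/2) × (t₀ - 1/2, t₀)`
  have hplateau : ∀ t ∈ Ioo (t₀ - 1 / 2) t₀, ∀ y ∈ ball x₀ (1 / 2), M / 2 ≤ f t y := by
    intro t ht y hy
    have hs : t - (t₀ - 1) ∈ Ioo (1 / 2 : ℝ) 1 := ⟨by linarith [ht.1], by linarith [ht.2]⟩
    have hy' : y - x₀ ∈ Ω' := by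
      rw [hΩ'_def, mem_ball, dist_zero_right, ← dist_eq_norm]; exact hy
    have hval := key _ hs _ hy'
    have e : F (t - (t₀ - 1)) (y - x₀) + 0 = f t y := by
      rw [add_zero, hFval]
      congr 1
      · ring
      · abel
    rw [e] at hval
    linarith
  -- a time in the plateau window where the `L^p` bound holds
  obtain ⟨t₁, ht₁, hLp₁⟩ := exists_mem_Ioo_of_ae_restrict_Iio hLp
    (by linarith : t₀ - 1 / 2 < t₀) ht₀.le
  have ht₁0 : t₁ < 0 := ht₁.2.trans ht₀
  -- the packing bound at time `t₁`
  have hpack := lintegral_ge_packing_of_isAxisymmetricScalar (hax t₁ ht₁0) (x₀ := x₀)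
    (ρ := 1 / 2) (m := M / 2) (by norm_num) (by linarith)
    (fun y hy => hplateau t₁ ht₁ y hy) hq
  -- `∫ |f t₁|^q = ‖f t₁‖_p^q ≤ K^q`
  have hint : ∫⁻ y, ‖f t₁ y‖ₑ ^ q = eLpNorm (f t₁) p volume ^ q := by
    rw [eLpNorm_eq_eLpNorm' hp0 hpt, lintegral_rpow_enorm_eq_rpow_eLpNorm' hq]
  have hKq : eLpNorm (f t₁) p volume ^ q ≤ (K : ℝ≥0∞) ^ q := ENNReal.rpow_le_rpow hLp₁ hq.le
  have hmain : ENNReal.ofReal (cylRadius x₀ / (1 / 2)) * (ENNReal.ofReal (M / 2) ^ q * v) ≤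
      (K : ℝ≥0∞) ^ q := (hpack.trans (hint.le.trans hKq))
  -- pass to real numbers
  have hKtop : (K : ℝ≥0∞) ^ q ≠ ⊤ := ENNReal.rpow_ne_top_of_nonneg hq.le ENNReal.coe_ne_top
  have hreal := ENNReal.toReal_mono hKtop hmain
  rw [ENNReal.toReal_mul, ENNReal.toReal_mul, ENNReal.toReal_ofReal (by positivity),
    ← ENNReal.toReal_rpow, ENNReal.toReal_ofReal (by positivity), ← ENNReal.toReal_rpow,
    ENNReal.coe_toReal] at hreal
  -- `2 r₀ (M/2)^q v ≤ K^q`, whereas `r₀ ≥ R > K^q / (2 v (M₀/2)^q)`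
  have hMq : (M₀ / 2) ^ q ≤ (M / 2) ^ q :=
    Real.rpow_le_rpow (by positivity) (by linarith) hq.le
  have hM₀q : 0 < (M₀ / 2) ^ q := Real.rpow_pos_of_pos (by positivity) q
  have h1' : cylRadius x₀ * (2 * v.toReal * (M₀ / 2) ^ q) ≤ (K : ℝ) ^ q := by
    have e : cylRadius x₀ / (1 / 2) * ((M / 2) ^ q * v.toReal) =
        cylRadius x₀ * (2 * v.toReal * (M / 2) ^ q) := by ring
    rw [e] at hreal
    have hmono : cylRadius x₀ * (2 * v.toReal * (M₀ / 2) ^ q) ≤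
        cylRadius x₀ * (2 * v.toReal * (M / 2) ^ q) := by
      apply mul_le_mul_of_nonneg_left _ (cylRadius_nonneg _)
      exact mul_le_mul_of_nonneg_left hMq (by positivity)
    exact hmono.trans hreal
  have h2' : cylRadius x₀ ≤ (K : ℝ) ^ q / (2 * v.toReal * (M₀ / 2) ^ q) := by
    rw [le_div_iff₀ (by positivity)]
    exact h1'
  linarith


/-- The hypotheses of the linear statements are invariant under `f ↦ −f` (the swirl equation is
linear and homogeneous; "Similarly, we can also get `m = 0`", Lei–Zhang–Zhao 2017, p. 12; cf. the
tree's `swirlDecay_eq_zero`). [cite: LeiZhangZhao2017, proof of Lemma 5.2 (arXiv p. 12)] -/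
theorem swirlLp_neg_hyps {f : ℝ → (EuclideanSpace ℝ (Fin 3)) → ℝ}
    {u : ℝ → (EuclideanSpace ℝ (Fin 3)) → (EuclideanSpace ℝ (Fin 3))}
    (h1 : ∀ t < 0, ContDiff ℝ ∞ (f t))
    (h2 : ContinuousOn (fun p : ℝ × (EuclideanSpace ℝ (Fin 3)) => fderiv ℝ (f p.1) p.2) (Iio 0 ×ˢ univ))
    (h3 : ContinuousOn (fun p : ℝ × (EuclideanSpace ℝ (Fin 3)) => (Δ (f p.1)) p.2) (Iio 0 ×ˢ univ))
    (hax : ∀ t < 0, IsAxisymmetricScalar (f t))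
    (h8 : ∀ x, cylRadius x ≠ 0 → ∀ s t : ℝ, s ≤ t → t < 0 →
      f t x - f s x = ∫ τ in s..t, ((Δ (f τ)) x - fderiv ℝ (f τ) x (u τ x) -
        2 / cylRadius x * partialDeriv (eR x) (f τ) x)) :
    (∀ t < 0, ContDiff ℝ ∞ (fun x => -f t x)) ∧
    ContinuousOn (fun p : ℝ × (EuclideanSpace ℝ (Fin 3)) => fderiv ℝ (fun x => -f p.1 x) p.2)
      (Iio 0 ×ˢ univ) ∧
    ContinuousOn (fun p : ℝ × (EuclideanSpace ℝ (Fin 3)) => (Δ fun x => -f p.1 x) p.2)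
      (Iio 0 ×ˢ univ) ∧
    (∀ t < 0, IsAxisymmetricScalar (fun x => -f t x)) ∧
    (∀ x, cylRadius x ≠ 0 → ∀ s t : ℝ, s ≤ t → t < 0 →
      (-f t x) - (-f s x) = ∫ τ in s..t, ((Δ fun y => -f τ y) x -
        fderiv ℝ (fun y => -f τ y) x (u τ x) -
        2 / cylRadius x * partialDeriv (eR x) (fun y => -f τ y) x)) := by
  have hneg : ∀ t, (fun x => -f t x) = -(f t) := fun t => rfl
  refine ⟨fun t ht => (h1 t ht).neg, ?_, ?_, ?_, ?_⟩
  · have : (fun p : ℝ × (EuclideanSpace ℝ (Fin 3)) => fderiv ℝ (fun x => -f p.1 x) p.2) =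
        fun p => -fderiv ℝ (f p.1) p.2 := funext fun p => fderiv_fun_neg
    rw [this]
    exact h2.neg
  · have : (fun p : ℝ × (EuclideanSpace ℝ (Fin 3)) => (Δ fun x => -f p.1 x) p.2) =
        fun p => -(Δ (f p.1)) p.2 :=
      funext fun p => by rw [hneg, InnerProductSpace.laplacian_neg]; rfl
    rw [this]
    exact h3.neg
  · intro t ht θ x
    show -f t (rotZ θ x) = -f t x
    rw [hax t ht θ x]
  · intro x hx s t hst ht
    have hint : (fun τ => (Δ fun y => -f τ y) x - fderiv ℝ (fun y => -f τ y) x (u τ x) -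
        2 / cylRadius x * partialDeriv (eR x) (fun y => -f τ y) x) =
        fun τ => -((Δ (f τ)) x - fderiv ℝ (f τ) x (u τ x) -
          2 / cylRadius x * partialDeriv (eR x) (f τ) x) := by
      funext τ
      rw [partialDeriv_apply, partialDeriv_apply, hneg, InnerProductSpace.laplacian_neg,
        fderiv_neg]
      simp only [Pi.neg_apply, neg_apply]
      ring
    rw [hint, intervalIntegral.integral_neg, ← h8 x hx s t hst ht]
    ring

/-- **No near-maximum of `|f|` far from the axis**: `swirlLp_far` for `f` and for `−f` — with the
notation there, for `M ≥ M₀`, `t₀ < 0`, `r(x₀) ≥ R`, if `|f| ≤ M` on `B(x₀, 1) × (t₀ − 1, t₀]` then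
`|f(t₀, x₀)| < (1 − δ)M`. [cite: LeiZhangZhao2017, Lemma 5.1 and its proof (arXiv pp. 10–11)] -/
theorem swirlLp_far_abs (hL21 : KNSS2009_lemma21 (EuclideanSpace ℝ (Fin 3)))
    {f : ℝ → (EuclideanSpace ℝ (Fin 3)) → ℝ} {u : ℝ → (EuclideanSpace ℝ (Fin 3)) → (EuclideanSpace ℝ (Fin 3))}
    {Cu : ℝ}
    (h1 : ∀ t < 0, ContDiff ℝ ∞ (f t))
    (h2 : ContinuousOn (fun p : ℝ × (EuclideanSpace ℝ (Fin 3)) => fderiv ℝ (f p.1) p.2) (Iio 0 ×ˢ univ))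
    (h3 : ContinuousOn (fun p : ℝ × (EuclideanSpace ℝ (Fin 3)) => (Δ (f p.1)) p.2) (Iio 0 ×ˢ univ))
    (hax : ∀ t < 0, IsAxisymmetricScalar (f t))
    (h6 : Measurable (uncurry u))
    (h7 : ∀ t < 0, ∀ x, ‖u t x‖ ≤ Cu)
    (h8 : ∀ x, cylRadius x ≠ 0 → ∀ s t : ℝ, s ≤ t → t < 0 →
      f t x - f s x = ∫ τ in s..t, ((Δ (f τ)) x - fderiv ℝ (f τ) x (u τ x) -
        2 / cylRadius x * partialDeriv (eR x) (f τ) x))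
    {p : ℝ≥0∞} {K : ℝ≥0} (hp0 : p ≠ 0) (hpt : p ≠ ⊤)
    (hLp : ∀ᵐ t ∂((volume : Measure ℝ).restrict (Iio 0)), eLpNorm (f t) p volume ≤ K) :
    ∃ δ : ℝ, 0 < δ ∧ δ < 1 ∧ ∀ M₀ : ℝ, 0 < M₀ → ∃ R : ℝ, 2 ≤ R ∧
      ∀ M : ℝ, M₀ ≤ M → ∀ t₀ < 0, ∀ x₀ : EuclideanSpace ℝ (Fin 3), R ≤ cylRadius x₀ →
        (∀ t ∈ Ioc (t₀ - 1) t₀, ∀ y ∈ ball x₀ 1, |f t y| ≤ M) → |f t₀ x₀| < M * (1 - δ) := by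
  obtain ⟨h1', h2', h3', hax', h8'⟩ := swirlLp_neg_hyps h1 h2 h3 hax h8
  have hLp' : ∀ᵐ t ∂((volume : Measure ℝ).restrict (Iio 0)),
      eLpNorm (fun x => -f t x) p volume ≤ K := by
    filter_upwards [hLp] with t ht
    have : (fun x => -f t x) = -(f t) := rfl
    rwa [this, eLpNorm_neg]
  obtain ⟨δ₁, hδ₁0, hδ₁1, hF₁⟩ := swirlLp_far hL21 h1 h2 h3 hax h6 h7 h8 hp0 hpt hLp
  obtain ⟨δ₂, hδ₂0, hδ₂1, hF₂⟩ := swirlLp_far hL21 h1' h2' h3' hax' h6 h7 h8' hp0 hpt hLp'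
  refine ⟨min δ₁ δ₂, lt_min hδ₁0 hδ₂0, lt_of_le_of_lt (min_le_left _ _) hδ₁1, fun M₀ hM₀ => ?_⟩
  obtain ⟨R₁, hR₁, hFR₁⟩ := hF₁ M₀ hM₀
  obtain ⟨R₂, hR₂, hFR₂⟩ := hF₂ M₀ hM₀
  refine ⟨max R₁ R₂, le_trans hR₁ (le_max_left _ _), fun M hM t₀ ht₀ x₀ hx₀ hloc => ?_⟩
  have hMpos : 0 < M := hM₀.trans_le hM
  have hx₁ : R₁ ≤ cylRadius x₀ := le_trans (le_max_left _ _) hx₀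
  have hx₂ : R₂ ≤ cylRadius x₀ := le_trans (le_max_right _ _) hx₀
  have hloc' : ∀ t ∈ Ioc (t₀ - 1) t₀, ∀ y ∈ ball x₀ 1, |(-f t y)| ≤ M := fun t ht y hy => by
    rw [abs_neg]; exact hloc t ht y hy
  have hup := hFR₁ M hM t₀ ht₀ x₀ hx₁ hloc
  have hdown := hFR₂ M hM t₀ ht₀ x₀ hx₂ hloc'
  have hm1 : M * (1 - δ₁) ≤ M * (1 - min δ₁ δ₂) := by
    have := min_le_left δ₁ δ₂
    nlinarith
  have hm2 : M * (1 - δ₂) ≤ M * (1 - min δ₁ δ₂) := by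
    have := min_le_right δ₁ δ₂
    nlinarith
  rw [abs_lt]
  constructor <;> linarith

/-! ### Lemma 5.1: boundedness and uniform radial decay of the swirl -/

/-- **Lei–Zhang–Zhao 2017, Lemma 5.1, first consequence: the swirl is bounded** (arXiv:1701.00868
p. 11: in print, `sup_{Q_{1/2}(x₀,t₀)} |Γ| ≤ C (∫_{Q_1} |Γ|^p)^{1/p} ≤ C ‖Γ‖_{L^∞_t L^p_x}` by the mean
value inequality (meanvalue); the boundedness of `Γ` is what the supremum `M = sup Γ` of Lemma 5.2
requires). **Statement.** Under the hypotheses of `swirlLp_far` and `|f(t, x)| ≤ C_g r(x)`, `f` is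
bounded on `(−∞, 0) × ℝ³`. **Proof.** With `δ`, `R_f = R(1)` from `swirlLp_far_abs`, let
`S(R) = sup{|f(t, x)| : t < 0, r(x) ≤ R} ≤ C_g R`. If `S(R + 1) ≤ (1 + δ/2) S(R)` then
`S(R) ≤ S_* = max(2 C_g R_f, 1)`: otherwise a point with `r(x₀) ≤ R`,
`|f(t₀, x₀)| > (1 − δ/2) S(R)` has either `r(x₀) < R_f`, where `|f| ≤ C_g R_f`, or `r(x₀) ≥ R_f`, where
it is a near-maximum of relative size `(1 − δ/2)/(1 + δ/2) ≥ 1 − δ` for the bound `M = S(R + 1)`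
valid on `B(x₀, 1)`, excluded by `swirlLp_far_abs`. If some `S(R₁) > S_*`, every `R₁ + n` violates
the ratio condition, so `S(R₁ + n) ≥ (1 + δ/2)ⁿ S(R₁)`, contradicting `S(R₁ + n) ≤ C_g (R₁ + n)`
(`tendsto_pow_const_div_const_pow_of_one_lt`). [cite: LeiZhangZhao2017, Lemma 5.1 and its proof (arXiv pp. 10–11)] -/
theorem swirlLp_bounded (hL21 : KNSS2009_lemma21 (EuclideanSpace ℝ (Fin 3)))
    {f : ℝ → (EuclideanSpace ℝ (Fin 3)) → ℝ} {u : ℝ → (EuclideanSpace ℝ (Fin 3)) → (EuclideanSpace ℝ (Fin 3))}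
    {Cg Cu : ℝ}
    (h1 : ∀ t < 0, ContDiff ℝ ∞ (f t))
    (h2 : ContinuousOn (fun p : ℝ × (EuclideanSpace ℝ (Fin 3)) => fderiv ℝ (f p.1) p.2) (Iio 0 ×ˢ univ))
    (h3 : ContinuousOn (fun p : ℝ × (EuclideanSpace ℝ (Fin 3)) => (Δ (f p.1)) p.2) (Iio 0 ×ˢ univ))
    (h4 : ∀ t < 0, ∀ x, |f t x| ≤ Cg * cylRadius x)
    (hax : ∀ t < 0, IsAxisymmetricScalar (f t))
    (h6 : Measurable (uncurry u))
    (h7 : ∀ t < 0, ∀ x, ‖u t x‖ ≤ Cu)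
    (h8 : ∀ x, cylRadius x ≠ 0 → ∀ s t : ℝ, s ≤ t → t < 0 →
      f t x - f s x = ∫ τ in s..t, ((Δ (f τ)) x - fderiv ℝ (f τ) x (u τ x) -
        2 / cylRadius x * partialDeriv (eR x) (f τ) x))
    {p : ℝ≥0∞} {K : ℝ≥0} (hp0 : p ≠ 0) (hpt : p ≠ ⊤)
    (hLp : ∀ᵐ t ∂((volume : Measure ℝ).restrict (Iio 0)), eLpNorm (f t) p volume ≤ K) :
    ∃ C : ℝ, ∀ t < 0, ∀ x, |f t x| ≤ C := by
  -- `C_g ≥ 0`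
  have hCg : 0 ≤ Cg := by
    have h := h4 (-1) (by norm_num) (EuclideanSpace.single 0 1)
    have hr : cylRadius (EuclideanSpace.single 0 1 : EuclideanSpace ℝ (Fin 3)) = 1 := by
      simp [cylRadius]
    rw [hr, mul_one] at h
    exact (abs_nonneg _).trans h
  obtain ⟨δ, hδ0, hδ1, hfar⟩ := swirlLp_far_abs hL21 h1 h2 h3 hax h6 h7 h8 hp0 hpt hLp
  obtain ⟨Rf, hRf2, hRf⟩ := hfar 1 one_pos
  -- the suprema over the solid cylinders `{r ≤ R}`
  set Φ : ℝ × EuclideanSpace ℝ (Fin 3) → ℝ := fun q => |f q.1 q.2| with hΦ_def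
  set A : ℝ → Set (ℝ × EuclideanSpace ℝ (Fin 3)) := fun R => {q | q.1 < 0 ∧ cylRadius q.2 ≤ R}
    with hA_def
  set B : ℝ → ℝ := fun R => sSup (Φ '' A R) with hB_def
  have hr0 : cylRadius (0 : EuclideanSpace ℝ (Fin 3)) = 0 := by simp [cylRadius]
  have hmem0 : ∀ R, 0 ≤ R → ((-1 : ℝ), (0 : EuclideanSpace ℝ (Fin 3))) ∈ A R := fun R hR =>
    ⟨by norm_num, by rw [hr0]; exact hR⟩
  have hne : ∀ R, 0 ≤ R → (Φ '' A R).Nonempty := fun R hR => ⟨_, mem_image_of_mem Φ (hmem0 R hR)⟩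
  have hbdd : ∀ R, 0 ≤ R → BddAbove (Φ '' A R) := by
    intro R hR
    refine ⟨Cg * R, ?_⟩
    rintro v ⟨q, hq, rfl⟩
    exact (h4 q.1 hq.1 q.2).trans (mul_le_mul_of_nonneg_left hq.2 hCg)
  have hle : ∀ R, 0 ≤ R → ∀ t < 0, ∀ x, cylRadius x ≤ R → |f t x| ≤ B R := fun R hR t ht x hx =>
    le_csSup (hbdd R hR) (mem_image_of_mem Φ (show (t, x) ∈ A R from ⟨ht, hx⟩))
  have hBle : ∀ R, 0 ≤ R → B R ≤ Cg * R := by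
    intro R hR
    refine csSup_le (hne R hR) ?_
    rintro v ⟨q, hq, rfl⟩
    exact (h4 q.1 hq.1 q.2).trans (mul_le_mul_of_nonneg_left hq.2 hCg)
  have hB0 : ∀ R, 0 ≤ R → 0 ≤ B R := fun R hR =>
    (abs_nonneg _).trans (hle R hR (-1) (by norm_num) 0 (by rw [hr0]; exact hR))
  have hBmono : ∀ R R', 0 ≤ R → R ≤ R' → B R ≤ B R' := fun R R' hR hRR' =>
    csSup_le_csSup (hbdd R' (hR.trans hRR')) (hne R hR)
      (image_mono fun q hq => ⟨hq.1, hq.2.trans hRR'⟩)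
  have happr : ∀ R, 0 ≤ R → ∀ θ < B R, ∃ t < 0, ∃ x, cylRadius x ≤ R ∧ θ < |f t x| := by
    intro R hR θ hθ
    obtain ⟨v, ⟨q, hq, rfl⟩, hv⟩ := exists_lt_of_lt_csSup (hne R hR) hθ
    exact ⟨q.1, hq.1, q.2, hq.2, hv⟩
  -- the bound for "good" radii: `B (R + 1) ≤ (1 + δ/2) B R ⟹ B R ≤ S*`
  set Sstar : ℝ := max (2 * Cg * Rf) 1 with hSstar_def
  have hgood : ∀ R, 0 ≤ R → B (R + 1) ≤ (1 + δ / 2) * B R → B R ≤ Sstar := by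
    intro R hR hratio
    by_contra hgt
    push Not at hgt
    have hBpos : 0 < B R := lt_of_lt_of_le (lt_of_lt_of_le one_pos (le_max_right _ _)) hgt.le
    have hθ : (1 - δ / 2) * B R < B R := by nlinarith
    obtain ⟨t₀, ht₀, x₀, hx₀R, hnear⟩ := happr R hR _ hθ
    by_cases hrx : cylRadius x₀ < Rf
    · -- near the axis: `|f| ≤ C_g r ≤ C_g R_f`
      have hfx : |f t₀ x₀| ≤ Cg * Rf := (h4 t₀ ht₀ x₀).trans (mul_le_mul_of_nonneg_left hrx.le hCg)
      have hS1 : 2 * Cg * Rf ≤ Sstar := le_max_left _ _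
      nlinarith
    · -- far from the axis: the far-field lemma with the local bound `M = B (R + 1)`
      push Not at hrx
      set M : ℝ := B (R + 1) with hM_def
      have hBRM : B R ≤ M := hBmono R (R + 1) hR (by linarith)
      have hM1 : 1 ≤ M := le_trans (le_trans (le_max_right _ _) hgt.le) hBRM
      have hloc : ∀ t ∈ Ioc (t₀ - 1) t₀, ∀ y ∈ ball x₀ 1, |f t y| ≤ M := by
        intro t ht y hy
        refine hle (R + 1) (by linarith) t (lt_of_le_of_lt ht.2 ht₀) y ?_
        rw [mem_ball, dist_eq_norm] at hy
        have := cylRadius_le_cylRadius_add_norm_sub x₀ y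
        linarith
      have hlt := hRf M hM1 t₀ ht₀ x₀ hrx hloc
      -- `M (1 - δ) ≤ (1 + δ/2)(1 - δ) B R ≤ (1 - δ/2) B R`
      have h1'' : M * (1 - δ) ≤ (1 + δ / 2) * B R * (1 - δ) :=
        mul_le_mul_of_nonneg_right hratio (by linarith)
      have h2'' : (1 + δ / 2) * B R * (1 - δ) ≤ (1 - δ / 2) * B R := by nlinarith
      linarith
  -- every radius is good enough: `B R ≤ S*` for all `R ≥ 0`
  have hall : ∀ R, 0 ≤ R → B R ≤ Sstar := by
    intro R₁ hR₁
    by_contra hgt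
    push Not at hgt
    -- all the radii `R₁ + n` are bad, so `B` grows geometrically
    have hbad : ∀ n : ℕ, (1 + δ / 2) * B (R₁ + n) < B (R₁ + n + 1) := by
      intro n
      by_contra hle'
      push Not at hle'
      have hg := hgood (R₁ + n) (by positivity) hle'
      have hmono := hBmono R₁ (R₁ + n) hR₁ (by simp)
      linarith
    have hgrow : ∀ n : ℕ, (1 + δ / 2) ^ n * B R₁ ≤ B (R₁ + n) := by
      intro n
      induction n with
      | zero => simp
      | succ n ih =>
        have h := hbad n
        have e : (R₁ + (n : ℝ) + 1) = R₁ + ((n + 1 : ℕ) : ℝ) := by push_cast; ring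
        rw [e] at h
        calc (1 + δ / 2) ^ (n + 1) * B R₁ = (1 + δ / 2) * ((1 + δ / 2) ^ n * B R₁) := by ring
          _ ≤ (1 + δ / 2) * B (R₁ + n) := mul_le_mul_of_nonneg_left ih (by linarith)
          _ ≤ B (R₁ + ((n + 1 : ℕ) : ℝ)) := h.le
    -- but `B (R₁ + n) ≤ C_g (R₁ + n)` grows only linearly
    have hlin : ∀ n : ℕ, (1 + δ / 2) ^ n * B R₁ ≤ Cg * R₁ + Cg * n := fun n =>
      (hgrow n).trans (by have := hBle (R₁ + n) (by positivity); linarith)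
    have h1lt : 1 < 1 + δ / 2 := by linarith
    have hlim : Tendsto (fun n : ℕ => (Cg * R₁ + Cg * n) / (1 + δ / 2) ^ n) atTop (𝓝 0) := by
      have hA := (tendsto_pow_const_div_const_pow_of_one_lt 0 h1lt).const_mul (Cg * R₁)
      have hB := (tendsto_pow_const_div_const_pow_of_one_lt 1 h1lt).const_mul Cg
      have hsum := hA.add hB
      rw [mul_zero, mul_zero, add_zero] at hsum
      refine hsum.congr fun n => ?_
      simp only [pow_zero, pow_one]
      ring
    have hBpos : 0 < B R₁ := lt_of_lt_of_le (lt_of_lt_of_le one_pos (le_max_right _ _)) hgt.le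
    obtain ⟨n, hn⟩ := ((tendsto_order.1 hlim).2 (B R₁) hBpos).exists
    have hpow : 0 < (1 + δ / 2) ^ n := pow_pos (by linarith) n
    have : B R₁ ≤ (Cg * R₁ + Cg * n) / (1 + δ / 2) ^ n := by
      rw [le_div_iff₀ hpow, mul_comm]
      exact hlin n
    linarith
  exact ⟨Sstar, fun t ht x => (hle (cylRadius x) (cylRadius_nonneg x) t ht x le_rfl).trans
    (hall _ (cylRadius_nonneg x))⟩

/-- **Lei–Zhang–Zhao 2017, Lemma 5.1** (arXiv:1701.00868 p. 10: "Let `v` be a bounded ancient mild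
solution of the axially symmetric Navier–Stokes equations. `Γ = r v_θ`. If
`Γ ∈ L^∞_t L^p_x(ℝ³ × (−∞, 0))`, where `1 ≤ p < ∞`, then `lim_{r→∞} Γ(x, t) = 0` holds uniformly for
`t` and `z`"), **the linear content, for the smooth representative.** For a scalar `f` and a drift
`u` as in `swirlDecay_eq_zero` — smooth slices, `∇f`, `Δf` jointly continuous, `|f| ≤ C_g r`, `u`
jointly measurable and bounded, the swirl equation `fₜ + u·∇f + (2/r)∂ᵣf = Δf` off the axis in
time-integrated form — with `f(t, ·)` axisymmetric and `‖f(t, ·)‖_{L^p} ≤ K` for a.e. `t < 0`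
(`0 < p < ∞`): for every `ε > 0` there is `R` with `|f(t, x)| ≤ ε` whenever `t < 0`, `r(x) ≥ R`.
**Proof** (print: Moser's mean value inequality and the disjoint balls of Step 2; here Step 1 is
replaced by KNSS's Lemma 2.1, module docstring). `f` is bounded (`swirlLp_bounded`), so
`D(R) = sup{|f(t, x)| : t < 0, r(x) ≥ R}` is finite and non-increasing; if the conclusion failed for
some `ε`, then `L = inf_R D(R) ≥ ε > 0`; choose `R₁` with `D(R₁) < (1 + δ/2)L` and, beyond the radius
`max(R₁ + 1, R(L))` of `swirlLp_far_abs`, a point with `|f(t₀, x₀)| > (1 − δ/2) D ≥ (1 − δ/2)L`; on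
`B(x₀, 1)` the bound `M = D(R₁)` holds, and `(1 − δ)M < (1 − δ)(1 + δ/2)L ≤ (1 − δ/2)L` contradicts
`swirlLp_far_abs`. [cite: LeiZhangZhao2017, Lemma 5.1 and its proof (arXiv pp. 10–11); KochNadirashviliSereginSverak2009, Lemma 2.1 (arXiv p. 5)] -/
theorem swirlLp_radial_decay (hL21 : KNSS2009_lemma21 (EuclideanSpace ℝ (Fin 3)))
    {f : ℝ → (EuclideanSpace ℝ (Fin 3)) → ℝ} {u : ℝ → (EuclideanSpace ℝ (Fin 3)) → (EuclideanSpace ℝ (Fin 3))}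
    {Cg Cu : ℝ}
    (h1 : ∀ t < 0, ContDiff ℝ ∞ (f t))
    (h2 : ContinuousOn (fun p : ℝ × (EuclideanSpace ℝ (Fin 3)) => fderiv ℝ (f p.1) p.2) (Iio 0 ×ˢ univ))
    (h3 : ContinuousOn (fun p : ℝ × (EuclideanSpace ℝ (Fin 3)) => (Δ (f p.1)) p.2) (Iio 0 ×ˢ univ))
    (h4 : ∀ t < 0, ∀ x, |f t x| ≤ Cg * cylRadius x)
    (hax : ∀ t < 0, IsAxisymmetricScalar (f t))
    (h6 : Measurable (uncurry u))
    (h7 : ∀ t < 0, ∀ x, ‖u t x‖ ≤ Cu)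
    (h8 : ∀ x, cylRadius x ≠ 0 → ∀ s t : ℝ, s ≤ t → t < 0 →
      f t x - f s x = ∫ τ in s..t, ((Δ (f τ)) x - fderiv ℝ (f τ) x (u τ x) -
        2 / cylRadius x * partialDeriv (eR x) (f τ) x))
    {p : ℝ≥0∞} {K : ℝ≥0} (hp0 : p ≠ 0) (hpt : p ≠ ⊤)
    (hLp : ∀ᵐ t ∂((volume : Measure ℝ).restrict (Iio 0)), eLpNorm (f t) p volume ≤ K) :
    ∀ ε > 0, ∃ R : ℝ, ∀ t < 0, ∀ x, R ≤ cylRadius x → |f t x| ≤ ε := by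
  obtain ⟨C, hC⟩ := swirlLp_bounded hL21 h1 h2 h3 h4 hax h6 h7 h8 hp0 hpt hLp
  obtain ⟨δ, hδ0, hδ1, hfar⟩ := swirlLp_far_abs hL21 h1 h2 h3 hax h6 h7 h8 hp0 hpt hLp
  intro ε hε
  by_contra hno
  push Not at hno
  -- the suprema over the exterior regions `{r ≥ R}`
  set Φ : ℝ × EuclideanSpace ℝ (Fin 3) → ℝ := fun q => |f q.1 q.2| with hΦ_def
  set A : ℝ → Set (ℝ × EuclideanSpace ℝ (Fin 3)) := fun R => {q | q.1 < 0 ∧ R ≤ cylRadius q.2}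
    with hA_def
  set D : ℝ → ℝ := fun R => sSup (Φ '' A R) with hD_def
  have hne : ∀ R, (Φ '' A R).Nonempty := by
    intro R
    obtain ⟨t, ht, x, hx, -⟩ := hno R
    exact ⟨_, mem_image_of_mem Φ (show (t, x) ∈ A R from ⟨ht, hx⟩)⟩
  have hbdd : ∀ R, BddAbove (Φ '' A R) := by
    intro R
    refine ⟨C, ?_⟩
    rintro v ⟨q, hq, rfl⟩
    exact hC q.1 hq.1 q.2
  have hle : ∀ R, ∀ t < 0, ∀ x, R ≤ cylRadius x → |f t x| ≤ D R := fun R t ht x hx =>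
    le_csSup (hbdd R) (mem_image_of_mem Φ (show (t, x) ∈ A R from ⟨ht, hx⟩))
  have hDε : ∀ R, ε < D R := by
    intro R
    obtain ⟨t, ht, x, hx, hεx⟩ := hno R
    exact hεx.trans_le (hle R t ht x hx)
  have hDanti : ∀ R R', R ≤ R' → D R' ≤ D R := fun R R' hRR' =>
    csSup_le_csSup (hbdd R) (hne R') (image_mono fun q hq => ⟨hq.1, hRR'.trans hq.2⟩)
  have happr : ∀ R, ∀ θ < D R, ∃ t < 0, ∃ x, R ≤ cylRadius x ∧ θ < |f t x| := by
    intro R θ hθ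
    obtain ⟨v, ⟨q, hq, rfl⟩, hv⟩ := exists_lt_of_lt_csSup (hne R) hθ
    exact ⟨q.1, hq.1, q.2, hq.2, hv⟩
  -- the limit `L = inf_R D R ≥ ε > 0`
  set L : ℝ := sInf (range D) with hL_def
  have hLbdd : BddBelow (range D) := ⟨ε, by rintro v ⟨R, rfl⟩; exact (hDε R).le⟩
  have hLle : ∀ R, L ≤ D R := fun R => csInf_le hLbdd ⟨R, rfl⟩
  have hεL : ε ≤ L := le_csInf (range_nonempty D) (by rintro v ⟨R, rfl⟩; exact (hDε R).le)
  have hL0 : 0 < L := hε.trans_le hεL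
  -- a radius `R₁` with `D R₁ < L (1 + δ/2)`
  obtain ⟨v, ⟨R₁, rfl⟩, hR₁⟩ := exists_lt_of_csInf_lt (range_nonempty D)
    (by nlinarith : L < L * (1 + δ / 2))
  obtain ⟨Rf, hRf2, hRf⟩ := hfar L hL0
  set R₂ : ℝ := max (R₁ + 1) Rf with hR₂_def
  -- a near-maximum of `D R₂` at radius `≥ R₂`
  have hDR₂ : L ≤ D R₂ := hLle R₂
  have hθ : (1 - δ / 2) * D R₂ < D R₂ := by nlinarith
  obtain ⟨t₀, ht₀, x₀, hx₀, hnear⟩ := happr R₂ _ hθ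
  -- the local bound `M = D R₁` on the unit ball around `x₀` (radius `> R₂ - 1 ≥ R₁`)
  set M : ℝ := D R₁ with hM_def
  have hM : L ≤ M := hLle R₁
  have hloc : ∀ t ∈ Ioc (t₀ - 1) t₀, ∀ y ∈ ball x₀ 1, |f t y| ≤ M := by
    intro t ht y hy
    refine hle R₁ t (lt_of_le_of_lt ht.2 ht₀) y ?_
    rw [mem_ball, dist_eq_norm] at hy
    have h1' := cylRadius_le_cylRadius_add_norm_sub y x₀
    have h2' : ‖x₀ - y‖ = ‖y - x₀‖ := norm_sub_rev _ _
    have h3' : R₁ + 1 ≤ R₂ := le_max_left _ _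
    linarith
  have hlt := hRf M hM t₀ ht₀ x₀ (le_trans (le_max_right _ _) hx₀) hloc
  -- `|f t₀ x₀| < M (1 - δ) < L (1 + δ/2)(1 - δ) ≤ (1 - δ/2) L ≤ (1 - δ/2) D R₂ < |f t₀ x₀|`
  have h1'' : M * (1 - δ) < L * (1 + δ / 2) * (1 - δ) :=
    mul_lt_mul_of_pos_right hR₁ (by linarith)
  have h2'' : L * (1 + δ / 2) * (1 - δ) ≤ (1 - δ / 2) * L := by nlinarith
  have h3'' : (1 - δ / 2) * L ≤ (1 - δ / 2) * D R₂ := mul_le_mul_of_nonneg_left hDR₂ (by linarith)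
  linarith


/-- **Lei–Zhang–Zhao 2017, Lemmas 5.1 and 5.2 combined: a solution of the swirl equation in
`L^∞_t L^p_x` vanishes** (arXiv:1701.00868 §5, pp. 10–12: Lemma 5.1 gives the uniform radial decay,
Lemma 5.2 then gives `Γ ≡ 0`). Under the hypotheses of `swirlLp_radial_decay`, `f ≡ 0` on `t < 0`:
the radial decay of `swirlLp_radial_decay` is the hypothesis of the tree's maximum-principle core
of Lemma 5.2, `swirlDecay_eq_zero`. [cite: LeiZhangZhao2017, Lemmas 5.1–5.2 (arXiv pp. 10–12)] -/
theorem swirlLp_eq_zero (hL21 : KNSS2009_lemma21 (EuclideanSpace ℝ (Fin 3)))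
    {f : ℝ → (EuclideanSpace ℝ (Fin 3)) → ℝ} {u : ℝ → (EuclideanSpace ℝ (Fin 3)) → (EuclideanSpace ℝ (Fin 3))}
    {Cg Cu : ℝ}
    (h1 : ∀ t < 0, ContDiff ℝ ∞ (f t))
    (h2 : ContinuousOn (fun p : ℝ × (EuclideanSpace ℝ (Fin 3)) => fderiv ℝ (f p.1) p.2) (Iio 0 ×ˢ univ))
    (h3 : ContinuousOn (fun p : ℝ × (EuclideanSpace ℝ (Fin 3)) => (Δ (f p.1)) p.2) (Iio 0 ×ˢ univ))
    (h4 : ∀ t < 0, ∀ x, |f t x| ≤ Cg * cylRadius x)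
    (hax : ∀ t < 0, IsAxisymmetricScalar (f t))
    (h6 : Measurable (uncurry u))
    (h7 : ∀ t < 0, ∀ x, ‖u t x‖ ≤ Cu)
    (h8 : ∀ x, cylRadius x ≠ 0 → ∀ s t : ℝ, s ≤ t → t < 0 →
      f t x - f s x = ∫ τ in s..t, ((Δ (f τ)) x - fderiv ℝ (f τ) x (u τ x) -
        2 / cylRadius x * partialDeriv (eR x) (f τ) x))
    {p : ℝ≥0∞} {K : ℝ≥0} (hp0 : p ≠ 0) (hpt : p ≠ ⊤)
    (hLp : ∀ᵐ t ∂((volume : Measure ℝ).restrict (Iio 0)), eLpNorm (f t) p volume ≤ K) :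
    ∀ t < 0, ∀ x, f t x = 0 :=
  swirlDecay_eq_zero hL21 h1 h2 h3 h4
    (swirlLp_radial_decay hL21 h1 h2 h3 h4 hax h6 h7 h8 hp0 hpt hLp) h6 h7 h8


/-! ### Theorem 1.3 for KNSS's bounded weak solutions: the solution is swirl-free -/

-- buildfix (Literature FQN clash #6 = DUP-FQN set 022): `LeiZhangZhao2017LiouvilleSwirlLp.lean` (p46366) owns the constants
-- `Literature.Analysis.FluidPDE.leiZhangZhao2017_Lp_ae_swirl_free` and `…leiZhangZhao2017_liouville_swirl_Lp_holds`, so that module and this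
-- importer-less one could not be co-imported (`Literature` root aggregate).  The first (text unchanged, a DIFFERENT statement: it takes KNSS's
-- regularity as a hypothesis) therefore lives in the sub-namespace `SelfSimilar` and is re-exported under its old name as an alias for importers of
-- this module alone; the second (identical statement, independent proof) is kept as an `example` (see there).
namespace SelfSimilar

/-- **Lei–Zhang–Zhao 2017, Theorem 1.3 up to "`v_θ ≡ 0`", in KNSS's class of bounded weak
solutions** (arXiv:1701.00868, §5: Lemmas 5.1–5.2 give "`Γ ≡ 0` in `(−∞, 0) × ℝ³` which implies
`v_θ ≡ 0`"; the solutions are KNSS's bounded ancient solutions, smooth by KNSS 2009 §4). Let `u` be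
a bounded weak solution of Navier–Stokes (`ν = 1`) in `ℝ³ × (−∞, 0)`
(`IsBoundedWeakNSSolutionOn (Iio 0)`, the class `L^∞(ℝ³ × (−∞, 0))` of KNSS 2009, §4 (ii)),
axisymmetric as an `L^∞` function, whose swirl `Γ = swirl (u t) = x₀u₁ − x₁u₀ = r u_θ` satisfies
`‖Γ(t, ·)‖_{L^p(ℝ³)} ≤ K` for a.e. `t < 0`, for some `0 < p < ∞`. Then `u` is swirl-free:
`swirl (u t) = 0` a.e., for a.e. `t < 0`. **Proof** — as the tree's `leiZhangZhao2017_ae_swirl_free`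
(the radially decaying case): by KNSS's §4 regularity with the swirl equation (5.10) for the
axisymmetric representative (`KNSS2009_regularity_axisymmetric_swirl`), `u = U + β(t) e_z` a.e.
for a.e. `t`, with `U` smooth, axisymmetric, bounded with bounded derivatives, Lipschitz in time,
and `Γ_U = swirl (U t)` solving (5.10) with the bounded drift `U + β e_z` off the axis;
`|Γ_U| ≤ r ‖U + β e_z‖`; `Γ_U(t, ·) = Γ(t, ·)` a.e. for a.e. `t` (axial drifts and null sets do not
change the swirl), so `‖Γ_U(t, ·)‖_p ≤ K` for a.e. `t`; hence `Γ_U ≡ 0` by `swirlLp_eq_zero`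
(Lemma 5.1 here, Lemma 5.2 from the tree), and `swirl (u t) = swirl (U t)` a.e. [cite: LeiZhangZhao2017, Thm 1.3 and §5, Lemmas 5.1–5.2 (arXiv pp. 4, 10–12)] -/
theorem leiZhangZhao2017_Lp_ae_swirl_free (hreg : KNSS2009_regularity_axisymmetric_swirl)
    (hL21 : KNSS2009_lemma21 (EuclideanSpace ℝ (Fin 3))) {u : ℝ → (EuclideanSpace ℝ (Fin 3)) → (EuclideanSpace ℝ (Fin 3))}
    (hu : IsBoundedWeakNSSolutionOn (Iio 0) isOpen_Iio 1 u)
    (haxi : ∀ θ : ℝ, ∀ᵐ t ∂((volume : Measure ℝ).restrict (Iio 0)),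
      (fun x => u t (rotZ θ x)) =ᵐ[volume] fun x => rotZ θ (u t x))
    {p : ℝ≥0∞} {K : ℝ≥0} (hp0 : p ≠ 0) (hpt : p ≠ ⊤)
    (hLp : ∀ᵐ t ∂((volume : Measure ℝ).restrict (Iio 0)), eLpNorm (swirl (u t)) p volume ≤ K) :
    ∀ᵐ t ∂((volume : Measure ℝ).restrict (Iio 0)), swirl (u t) =ᵐ[volume] (0 : (EuclideanSpace ℝ (Fin 3)) → ℝ) := by
  obtain ⟨U, β, hβm, ⟨Cβ, hCβ⟩, hUm, hrep, hsmooth, -, haxiU, hbd, hlip, hswirlEq⟩ := hreg hu haxi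
  set S : Set (ℝ × (EuclideanSpace ℝ (Fin 3))) := Iio 0 ×ˢ univ with hS
  -- smoothness of the slices in the degrees used below
  have hU2 : ∀ t < 0, ContDiff ℝ 2 (U t) := fun t ht => (hsmooth t ht).of_le (by norm_cast)
  have hU1 : ∀ t < 0, ContDiff ℝ 1 (U t) := fun t ht => (hsmooth t ht).of_le (by norm_cast)
  have hUd : ∀ t < 0, ∀ x, DifferentiableAt ℝ (U t) x := fun t ht x =>
    ((hU1 t ht).differentiable one_ne_zero) x
  -- (4.8) ⇒ joint continuity of `U`, `∇U`, `∇²U`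
  have hD : ∀ k : ℕ, ContinuousOn (fun p : ℝ × (EuclideanSpace ℝ (Fin 3)) => iteratedFDeriv ℝ k (U p.1) p.2) S := by
    intro k
    obtain ⟨L, hL⟩ := hlip k
    exact continuousOn_iteratedFDeriv_of_lipschitz hsmooth hL
  have hUc : ContinuousOn (fun p : ℝ × (EuclideanSpace ℝ (Fin 3)) => U p.1 p.2) S := by
    have h := (ContinuousMultilinearMap.apply ℝ (fun _ : Fin 0 => (EuclideanSpace ℝ (Fin 3))) (EuclideanSpace ℝ (Fin 3))
      (Fin.elim0 : Fin 0 → (EuclideanSpace ℝ (Fin 3)))).continuous.comp_continuousOn (hD 0)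
    refine h.congr fun p _ => ?_
    simp only [comp_apply, ContinuousMultilinearMap.apply_apply, iteratedFDeriv_zero_apply]
  have hD1c : ∀ y : (EuclideanSpace ℝ (Fin 3)), ContinuousOn (fun p : ℝ × (EuclideanSpace ℝ (Fin 3)) => fderiv ℝ (U p.1) p.2 y) S := by
    intro y
    have h := (ContinuousMultilinearMap.apply ℝ (fun _ : Fin 1 => (EuclideanSpace ℝ (Fin 3))) (EuclideanSpace ℝ (Fin 3))
      (fun _ => y)).continuous.comp_continuousOn (hD 1)
    refine h.congr fun p _ => ?_
    simp only [comp_apply, ContinuousMultilinearMap.apply_apply, iteratedFDeriv_one_apply]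
  have hD2c : ∀ m : Fin 2 → (EuclideanSpace ℝ (Fin 3)),
      ContinuousOn (fun p : ℝ × (EuclideanSpace ℝ (Fin 3)) => iteratedFDeriv ℝ 2 (U p.1) p.2 m) S := fun m =>
    (ContinuousMultilinearMap.apply ℝ (fun _ : Fin 2 => (EuclideanSpace ℝ (Fin 3))) (EuclideanSpace ℝ (Fin 3)) m).continuous.comp_continuousOn
      (hD 2)
  -- the bounds: `‖U‖ ≤ C₀`, `‖U + β e_z‖ ≤ C₀ + C_β`, `|Γ_U| ≤ (C₀ + C_β) r`
  obtain ⟨C₀, hC₀⟩ := hbd 0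
  have hU0 : ∀ t < 0, ∀ x, ‖U t x‖ ≤ C₀ := fun t ht x => by
    rw [← norm_iteratedFDeriv_zero (𝕜 := ℝ)]; exact hC₀ t ht x
  have heZ : ‖(eZ : (EuclideanSpace ℝ (Fin 3)))‖ = 1 := by simp [eZ]
  have hdrift : ∀ t < 0, ∀ x, ‖U t x + β t • eZ‖ ≤ C₀ + Cβ := fun t ht x =>
    (norm_add_le _ _).trans (add_le_add (hU0 t ht x)
      (by rw [norm_smul, heZ, mul_one, Real.norm_eq_abs]; exact hCβ t))
  have haxis : ∀ t < 0, ∀ x, |swirl (U t) x| ≤ (C₀ + Cβ) * cylRadius x := fun t ht x =>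
    (abs_swirl_le_cylRadius_mul_norm_add_smul_eZ (U t) (β t) x).trans (by
      rw [mul_comm]
      exact mul_le_mul_of_nonneg_right (hdrift t ht x) (cylRadius_nonneg x))
  -- the swirl of `U` is an axisymmetric scalar
  have haxS : ∀ t < 0, IsAxisymmetricScalar (fun x => swirl (U t) x) := fun t ht =>
    (haxiU t ht).isAxisymmetricScalar_swirl
  -- the `L^p` bound for the swirl of the representative, for a.e. `t < 0`
  have hLpU : ∀ᵐ t ∂((volume : Measure ℝ).restrict (Iio 0)),
      eLpNorm (fun x => swirl (U t) x) p volume ≤ K := by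
    filter_upwards [hrep, hLp] with s hs hLs
    have hae : (fun x => swirl (U s) x) =ᵐ[volume] swirl (u s) := by
      filter_upwards [hs] with y hy
      have : swirl (u s) y = swirl (fun y => U s y + β s • eZ) y := by simp only [swirl, hy]
      rw [this, swirl_add_smul_eZ]
    rw [eLpNorm_congr_ae hae]
    exact hLs
  -- `swirl U ≡ 0`: radial decay from the `L^p` bound, then the maximum-principle core
  have hzero : ∀ t < 0, ∀ x, swirl (U t) x = 0 := by
    refine swirlLp_eq_zero hL21 (f := fun t x => swirl (U t) x) (u := fun t x => U t x + β t • eZ)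
      (fun t ht => contDiff_swirl (hsmooth t ht)) ?_ ?_ haxis haxS ?_ hdrift hswirlEq hp0 hpt hLpU
    · -- `∇Γ` jointly continuous: `DΓ(x)y = ⟪Jx, DU(x)y⟫ + ⟪Jy, U(x)⟫`
      refine continuousOn_clm_apply.2 fun y => ?_
      have hG : ContinuousOn
          (fun p : ℝ × (EuclideanSpace ℝ (Fin 3)) => ⟪rotGen p.2, fderiv ℝ (U p.1) p.2 y⟫ + ⟪rotGen y, U p.1 p.2⟫) S :=
        ((rotGenL.continuous.comp continuous_snd).continuousOn.inner (hD1c y)).add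
          (continuousOn_const.inner hUc)
      refine hG.congr fun p hp => ?_
      exact fderiv_swirl_apply (hUd p.1 hp.1 p.2) y
    · -- `ΔΓ` jointly continuous: `ΔΓ = ⟪Jx, ΔU⟫ + 2(∂₀U₁ − ∂₁U₀)`, `ΔU = Σᵢ D²U[eᵢ, eᵢ]`
      classical
      set b := EuclideanSpace.basisFun (Fin 3) ℝ with hb
      have hΔU : ContinuousOn (fun p : ℝ × (EuclideanSpace ℝ (Fin 3)) => (Δ (U p.1)) p.2) S := by
        have h : ContinuousOn
            (fun p : ℝ × (EuclideanSpace ℝ (Fin 3)) => ∑ i, iteratedFDeriv ℝ 2 (U p.1) p.2 ![b i, b i]) S :=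
          continuousOn_finsetSum _ fun i _ => hD2c _
        refine h.congr fun p _ => ?_
        exact congrFun (laplacian_eq_iteratedFDeriv_orthonormalBasis (U p.1) b) p.2
      have hG : ContinuousOn (fun p : ℝ × (EuclideanSpace ℝ (Fin 3)) => ⟪rotGen p.2, (Δ (U p.1)) p.2⟫ +
          2 * (fderiv ℝ (U p.1) p.2 (EuclideanSpace.single 0 1) 1 -
            fderiv ℝ (U p.1) p.2 (EuclideanSpace.single 1 1) 0)) S :=
        ((rotGenL.continuous.comp continuous_snd).continuousOn.inner hΔU).add
          (continuousOn_const.mul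
            (((PiLp.continuous_apply 2 _ 1).comp_continuousOn (hD1c _)).sub
              ((PiLp.continuous_apply 2 _ 0).comp_continuousOn (hD1c _))))
      refine hG.congr fun p hp => ?_
      exact laplacian_swirl (hU2 p.1 hp.1) p.2
    · -- the drift is jointly measurable
      show Measurable fun p : ℝ × (EuclideanSpace ℝ (Fin 3)) => U p.1 p.2 + β p.1 • eZ
      exact hUm.add ((hβm.comp measurable_fst).smul_const eZ)
  -- transfer to `u = U + β e_z` (a.e.)
  filter_upwards [hrep, ae_restrict_mem measurableSet_Iio] with t ht htneg
  filter_upwards [ht] with x hx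
  have h0 := hzero t htneg x
  have e : swirl (u t) x = swirl (fun y => U t y + β t • eZ) x := by simp only [swirl, hx]
  rw [e, swirl_add_smul_eZ]
  exact h0

/-! ### Theorem 1.3 in the tree's duality-form class -/

/- (doc of the former theorem `leiZhangZhao2017_liouville_swirl_Lp_holds`, now an `example` — see the buildfix note below) **Lei–Zhang–Zhao 2017, Theorem 1.3 (`leiZhangZhao2017_liouville_swirl_Lp`), PROVED** (Z. Lei,
Q. S. Zhang, N. Zhao, *Improved Liouville theorems for axially symmetric Navier–Stokes equations*,
arXiv:1701.00868 = Sci. Sin. Math. 47 (2017), Theorem 1.3, p. 4: "Let `v` be a bounded ancient mild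
solution of the 3D axially symmetric Navier–Stokes equations with `v_θ ≠ 0` and let `Γ = r v_θ`. If
`Γ ∈ L^∞_t L^p_x(ℝ³ × (−∞, 0))` where `1 ≤ p < ∞`, then `v` must be a constant"; proof in §5,
Lemma 5.1 (uniform radial decay of `Γ`) and Lemma 5.2 (`Γ ≡ 0`), then KNSS 2009, Theorem 5.2).
**Proof** — the printed one, transported to the duality-form class exactly as Remark 1.4 is in the
tree's `leiZhangZhao2017_liouville_swirl_decay_holds` (whose bridge, that of
`knss_axisymmetric_no_swirl_of_KNSS2009`, is repeated verbatim): a bounded ancient mild solution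
with measurable axisymmetric slices differs slice-wise from a jointly measurable bounded weak
solution `ũ = w + c̃ e_z` of KNSS's class by null sets and an axial drift `(c̃ − c)(t) e_z`
(`exists_modification_sub_average`, the measurable substitute `c̃` of the axial average `c`, the
invariance of the slices under vertical translations off the honest set, and the drift lemma
`IsBoundedAncientMildSolution.add_timeConst_smul_of_ae_invariant`); the swirl sees neither null sets
nor axial drifts, so `‖swirl (ũ t)‖_p = ‖swirl (u t)‖_p ≤ K` for every `t < 0` and `ũ` is swirl-free
a.e. by Lemmas 5.1–5.2 (`leiZhangZhao2017_Lp_ae_swirl_free`, with KNSS's §4 regularity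
`KNSS2009_regularity_axisymmetric_swirl_holds` and Lemma 2.1 `KNSS2009_lemma21_holds`); KNSS's
Theorem 5.2 as printed (`KNSS2009_liouville_axisymmetric_no_swirl_holds`) makes the slices of `ũ`,
hence of `u`, a.e. equal to `b(t) e_z` for a.e. `t`, and the continuity of the solenoidal pairings
upgrades this to every `t < 0` (`IsBoundedAncientMildSolution.exists_ae_eq_const_slice`), the
constant being axial (`eq_smul_eZ_of_ae_eq_const_of_isAxisymmetric`). The one deviation from the
printed proof of Lemma 5.1 (KNSS's Lemma 2.1 in place of the Nash–Moser mean value inequality) is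
recorded in the module docstring and at `swirlLp_far`. [cite: LeiZhangZhao2017, Thm 1.3 (arXiv p. 4) with Lemmas 5.1–5.2 (pp. 10–12); KochNadirashviliSereginSverak2009, Thm 5.2 (arXiv pp. 9–10)] -/
-- buildfix (clash #6): this statement is ALREADY landed, importably, as
-- `Literature.Analysis.FluidPDE.leiZhangZhao2017_liouville_swirl_Lp_holds` in `LeiZhangZhao2017LiouvilleSwirlLp.lean` (p46366) — the
-- theorem of record.  The gate's dedup rule forbids restating it under any name, so this module's independent proof (via KNSS's
-- Lemma 2.1 route above) is kept kernel-checked as an `example` instead of a second declaration.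
example : leiZhangZhao2017_liouville_swirl_Lp := by
  intro u hu hmeas haxi hLp
  obtain ⟨pexp, K, hp1, hptop, hK⟩ := hLp
  have hp0 : pexp ≠ 0 := (zero_lt_one.trans_le hp1).ne'
  obtain ⟨M, hM'⟩ := hu.2
  have hM : ∀ t < 0, ∀ x, ‖u t x‖ ≤ M := fun t ht x => hM' t ht x
  have hM0 : 0 ≤ M := (norm_nonneg _).trans (hM (-1) (by norm_num) 0)
  have hν : (0 : ℝ) < 1 := one_pos
  -- (i) a radial weight and the axial average `c t e_z`
  obtain ⟨g, hg, hg0, hg1, hgrad⟩ := exists_radial_test_weight (E := EuclideanSpace ℝ (Fin 3))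
  have hgc : Continuous g := hg.contDiff.continuous
  have hgi : Integrable g := hgc.integrable_of_hasCompactSupport hg.hasCompactSupport
  have hgrot : ∀ y, g (rotZ Real.pi y) = g y := fun y => hgrad _ _ (norm_rotZ _ _)
  set c : ℝ → ℝ := fun t => ∫ y, g y * u t y 2 with hc_def
  have havg : ∀ t < 0, ∫ y, g y • u t y = c t • eZ := fun t ht =>
    integral_smul_eq_smul_eZ_of_isAxisymmetric hgi hgrot (haxi t ht) (hmeas t ht) (hM t ht)
  have hcb : ∀ t < 0, |c t| ≤ M := by
    intro t ht
    have hint : Integrable fun y => g y * u t y 2 :=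
      Integrable.mono' (hgi.norm.mul_const M) (hgi.aestronglyMeasurable.mul
        ((EuclideanSpace.proj (2 : Fin 3)).continuous.comp_aestronglyMeasurable (hmeas t ht)))
        (Eventually.of_forall fun y => by
          rw [norm_mul]
          refine mul_le_mul_of_nonneg_left ?_ (norm_nonneg _)
          exact (by simpa using PiLp.norm_apply_le (u t y) 2 : ‖u t y 2‖ ≤ ‖u t y‖).trans (hM t ht y))
    calc |c t| = ‖∫ y, g y * u t y 2‖ := (Real.norm_eq_abs _).symm
      _ ≤ ∫ y, ‖g y‖ * M := norm_integral_le_of_norm_le (hgi.norm.mul_const M) (Eventually.of_forall fun y => by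
          rw [norm_mul]
          refine mul_le_mul_of_nonneg_left ?_ (norm_nonneg _)
          exact (by simpa using PiLp.norm_apply_le (u t y) 2 : ‖u t y 2‖ ≤ ‖u t y‖).trans (hM t ht y))
      _ = M := by
          rw [integral_mul_const]
          have : ∫ y, ‖g y‖ = 1 := by
            rw [← hg1]
            exact integral_congr_ae (Eventually.of_forall fun y => Real.norm_of_nonneg (hg0 y))
          rw [this, one_mul]
  -- (ii) the jointly measurable modification `w`, `u t = w t + c t e_z` a.e.
  obtain ⟨w, hw, ⟨B, hwB⟩, hwu⟩ :=
    hu.exists_modification_sub_average hν hmeas hgc hg.hasCompactSupport hg1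
  have hwu' : ∀ t < 0, w t =ᵐ[volume] fun x => u t x - c t • eZ := fun t ht =>
    (hwu t ht).trans (Eventually.of_forall fun x => by simp only [havg t ht])
  have huw : ∀ t < 0, u t =ᵐ[volume] fun x => w t x + c t • eZ := fun t ht => by
    filter_upwards [hwu' t ht] with x hx
    rw [hx, sub_add_cancel]
  have hwm : ∀ t, AEStronglyMeasurable (w t) volume := fun t =>
    (hw.comp_measurable measurable_prodMk_left).aestronglyMeasurable
  have hwdiv : ∀ t < 0, IsWeaklyDivFree (w t) := fun t ht =>
    isWeaklyDivFree_of_ae_eq_add_const (hu.1.1 t ht) (hmeas t ht) (hM t ht) (-(c t • eZ))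
      ((hwu' t ht).trans (Eventually.of_forall fun x => by simp only [sub_eq_add_neg]))
  -- (iii) `u' = w + c e_z`, a.e. equal to `u` slice-wise
  set u' : ℝ → EuclideanSpace ℝ (Fin 3) → EuclideanSpace ℝ (Fin 3) := fun t x => w t x + c t • eZ with hu'_def
  have hu'u : ∀ t < 0, u' t =ᵐ[volume] u t := fun t ht => (huw t ht).symm
  have heZ : ‖(eZ : EuclideanSpace ℝ (Fin 3))‖ = 1 := by simp [eZ]
  have hu'M : ∀ t < 0, ∀ x, ‖u' t x‖ ≤ B + M := fun t ht x =>
    (norm_add_le _ _).trans (add_le_add (hwB t x) (by rw [norm_smul, heZ, mul_one, Real.norm_eq_abs]; exact hcb t ht))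
  have hu'sol : IsBoundedAncientMildSolution 1 u' := hu.congr_ae_slice hu'u ⟨B + M, fun t ht x => hu'M t ht x⟩
  have hu'meas : ∀ t < 0, AEStronglyMeasurable (u' t) volume := fun t _ => (hwm t).add aestronglyMeasurable_const
  -- (v) a countable dense family of solenoidal tests; the cross terms `m` and their zero sets
  obtain ⟨φs, hφs, hdense⟩ := exists_seq_isDivFree_dense (E := EuclideanSpace ℝ (Fin 3))
  have hm_meas : ∀ (q : ℝ) (k : ℕ), Measurable fun τ =>
      ∫ x, ⟪w τ x, fderiv ℝ (heatTest 1 (φs k) (q - τ)) x eZ⟫ := fun q k =>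
    measurable_integral_inner_fderiv_heatTest_apply hw (hφs k).1 1 q eZ
  -- honest rational final times: non-constant slices
  set H : Set ℚ := {q | (q : ℝ) < 0 ∧ ∀ κ : EuclideanSpace ℝ (Fin 3), ¬ (u q =ᵐ[volume] fun _ => κ)} with hH_def
  set A : ℚ → ℕ → Set ℝ := fun q k =>
    {τ | τ < q ∧ (∫ x, ⟪w τ x, fderiv ℝ (heatTest 1 (φs k) (q - τ)) x eZ⟫) ≠ 0} with hA_def
  have hAm : ∀ q k, MeasurableSet (A q k) := fun q k =>
    measurableSet_Iio.inter ((hm_meas q k) (measurableSet_singleton (0 : ℝ)).compl)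
  set Gd : Set ℝ := ⋃ p : H × ℕ, A p.1 p.2 with hGd_def
  have hGm : MeasurableSet Gd := MeasurableSet.iUnion fun p => hAm _ _
  have hGd0 : Gd ⊆ Iio 0 := by
    intro τ hτ
    obtain ⟨p, hp⟩ := mem_iUnion.1 hτ
    exact lt_trans hp.1 p.1.2.1
  -- (iv)+(vii) `c` is a.e. measurable on `Gd`
  have hcA : ∀ (q : H) (k : ℕ), AEMeasurable c (volume.restrict (A q k)) := by
    intro q k
    have hq0 : ((q : ℚ) : ℝ) < 0 := q.2.1
    set qr : ℝ := ((q : ℚ) : ℝ) with hqr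
    -- the three functions of `τ`
    set Gf : ℝ → ℝ := fun τ => ∫ x, ⟪u τ x, convect (u τ) (heatTest 1 (φs k) (qr - τ)) x⟫ with hGf
    set Nf : ℝ → ℝ := fun τ => ∫ x, ⟪w τ x, fderiv ℝ (heatTest 1 (φs k) (qr - τ)) x (w τ x)⟫ with hNf
    set mf : ℝ → ℝ := fun τ => ∫ x, ⟪w τ x, fderiv ℝ (heatTest 1 (φs k) (qr - τ)) x eZ⟫ with hmf
    have hNm : Measurable Nf := measurable_integral_inner_fderiv_heatTest_self hw (hφs k).1 1 qr
    have hmm : Measurable mf := hm_meas qr k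
    -- the splitting `G = N + c m` at every `τ < 0`
    have hsplit : ∀ τ < 0, Gf τ = Nf τ + c τ * mf τ := by
      intro τ hτ
      have e1 : Gf τ = ∫ x, ⟪u' τ x, convect (u' τ) (heatTest 1 (φs k) (qr - τ)) x⟫ :=
        integral_inner_convect_heatTest_congr_ae (huw τ hτ) _
      rw [e1]
      simpa only [hu'_def, hNf, hmf, convect_apply] using
        integral_inner_convect_heatTest_add_const (hwm τ) (hwB τ) (hwdiv τ hτ) (c τ) eZ (hφs k).1 1 (qr - τ)
    -- honesty at `q`: `G` is integrable on every `(s, q)`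
    have hGint : ∀ s < qr, IntervalIntegrable Gf volume s qr := fun s hs =>
      hu.intervalIntegrable_nonlinear_of_not_ae_const hν hmeas hq0 q.2.2 hs (hφs k).1 (hφs k).2
    -- `c m = G - N` is a.e. measurable on every `(s, q)`, hence on `Iio q`
    have hcm_s : ∀ s < qr, AEMeasurable (fun τ => c τ * mf τ) (volume.restrict (Ioo s qr)) := by
      intro s hs
      have hGae : AEMeasurable Gf (volume.restrict (Ioo s qr)) :=
        ((hGint s hs).def'.mono_set (by rw [uIoc_of_le hs.le]; exact Ioo_subset_Ioc_self)).aestronglyMeasurable.aemeasurable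
      refine (hGae.sub hNm.aemeasurable).congr ?_
      refine (ae_restrict_mem measurableSet_Ioo).mono fun τ hτ => ?_
      have hτ0 : τ < 0 := hτ.2.trans hq0
      show Gf τ - Nf τ = c τ * mf τ
      rw [hsplit τ hτ0]
      ring
    have hcm : AEMeasurable (fun τ => c τ * mf τ) (volume.restrict (Iio qr)) := by
      have hcover : Iio qr = ⋃ n : ℕ, Ioo (qr - ((n : ℝ) + 1)) qr := by
        ext τ
        simp only [mem_Iio, mem_iUnion, mem_Ioo]
        constructor
        · intro hτ
          obtain ⟨n, hn⟩ := exists_nat_gt (qr - τ)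
          exact ⟨n, by linarith, hτ⟩
        · rintro ⟨n, -, hn2⟩
          exact hn2
      rw [hcover]
      exact aemeasurable_iUnion_iff.2 fun n => hcm_s _ (by linarith)
    -- on `A q k`, `m ≠ 0` and `c = (c m) / m`
    have hAsub : A q k ⊆ Iio qr := fun τ hτ => hτ.1
    have hcmA : AEMeasurable (fun τ => c τ * mf τ) (volume.restrict (A q k)) :=
      hcm.mono_measure (Measure.restrict_mono hAsub le_rfl)
    refine ((hcmA.div hmm.aemeasurable).congr ?_)
    refine (ae_restrict_mem (hAm q k)).mono fun τ hτ => ?_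
    show c τ * mf τ / mf τ = c τ
    exact mul_div_cancel_right₀ _ hτ.2
  have hcG : AEMeasurable c (volume.restrict Gd) := aemeasurable_iUnion_iff.2 fun p => hcA p.1 p.2
  -- the measurable, bounded substitute `ct` of `c`: `ct = c` a.e. on `Gd`, `ct = 0` off `Gd`
  set c₁ : ℝ → ℝ := hcG.mk c with hc₁_def
  have hc₁m : Measurable c₁ := hcG.measurable_mk
  have hcc₁ : ∀ᵐ τ ∂(volume.restrict Gd), c τ = c₁ τ := hcG.ae_eq_mk
  set ct : ℝ → ℝ := Gd.indicator fun τ => max (-M) (min M (c₁ τ)) with hct_def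
  have hctm : Measurable ct := (measurable_const.max (measurable_const.min hc₁m)).indicator hGm
  have hclip : ∀ y : ℝ, |max (-M) (min M y)| ≤ M := fun y =>
    abs_le.2 ⟨le_max_left _ _, max_le (by linarith) (min_le_left _ _)⟩
  have hctb : ∀ τ, |ct τ| ≤ M := by
    intro τ
    by_cases hτ : τ ∈ Gd
    · rw [hct_def, indicator_of_mem hτ]; exact hclip _
    · rw [hct_def, indicator_of_notMem hτ, abs_zero]; exact hM0
  have hct_on : ∀ᵐ τ ∂(volume : Measure ℝ), τ ∈ Gd → ct τ = c τ := by
    have h1 : ∀ᵐ τ ∂(volume : Measure ℝ), τ ∈ Gd → c τ = c₁ τ := (ae_restrict_iff' hGm).1 hcc₁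
    filter_upwards [h1] with τ hτ hmem
    have hc0 : |c τ| ≤ M := hcb τ (hGd0 hmem)
    rw [hct_def, indicator_of_mem hmem, ← hτ hmem]
    rw [abs_le] at hc0
    rw [min_eq_right hc0.2, max_eq_right hc0.1]
  -- (viii) off `Gd` the slices are invariant under the vertical translations
  have hinv_off : ∀ τ < 0, τ ∉ Gd → ∀ h : ℝ,
      (fun x => u τ (x + h • eZ)) =ᵐ[volume] u τ := by
    intro τ hτ hτG
    refine ae_eq_comp_add_smul_of_forall_integral_inner_fderiv_eq_zero (hmeas τ hτ) (hM τ hτ) (hu.1.1 τ hτ)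
      (fun φ hφ hdivφ => ?_)
    have hφ1 : ContDiff ℝ 1 φ := hφ.contDiff.of_le (by exact_mod_cast le_top)
    by_cases hacc : ∀ ε > (0 : ℝ), ∃ q : ℚ, q ∈ H ∧ τ < q ∧ (q : ℝ) < τ + ε
    · -- honest rational final times accumulate at `τ⁺`
      choose q hqH hτq hqε using fun n : ℕ => hacc (1 / ((n : ℝ) + 1)) (by positivity)
      have hσpos : ∀ n, 0 < (q n : ℝ) - τ := fun n => sub_pos.2 (hτq n)
      have hσ : Tendsto (fun n => (q n : ℝ) - τ) atTop (𝓝 0) := by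
        refine squeeze_zero (fun n => (hσpos n).le) (fun n => ?_) tendsto_one_div_add_atTop_nhds_zero_nat
        linarith [hqε n]
      -- `m^{qₙ}_k(τ) = 0`: otherwise `τ ∈ Gd`
      have hm0 : ∀ n k, ∫ x, ⟪w τ x, fderiv ℝ (heatTest 1 (φs k) ((q n : ℝ) - τ)) x eZ⟫ = 0 := by
        intro n k
        by_contra hne
        exact hτG (mem_iUnion.2 ⟨⟨⟨q n, hqH n⟩, k⟩, hτq n, hne⟩)
      -- transfer from `w τ` to `u τ = w τ + c τ e_z`
      have htrans : ∀ ψ : EuclideanSpace ℝ (Fin 3) → EuclideanSpace ℝ (Fin 3),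
          FunctionSpaces.IsTestFunctionOn (⊤ : Opens (EuclideanSpace ℝ (Fin 3))) ψ → ∀ σ : ℝ,
          ∫ x, ⟪u τ x, fderiv ℝ (heatTest 1 ψ σ) x eZ⟫ = ∫ x, ⟪w τ x, fderiv ℝ (heatTest 1 ψ σ) x eZ⟫ := by
        intro ψ hψ σ
        have hψ1 : ContDiff ℝ 1 ψ := hψ.contDiff.of_le (by exact_mod_cast le_top)
        have hDc : Continuous fun z => fderiv ℝ ψ z eZ := (hψ1.continuous_fderiv one_ne_zero).clm_apply continuous_const
        have hDi : Integrable fun x => fderiv ℝ (heatTest 1 ψ σ) x eZ := by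
          have : Integrable (heatFlow (fun z => fderiv ℝ ψ z eZ) (1 * σ)) :=
            integrable_heatFlow (hDc.integrable_of_hasCompactSupport (hψ.hasCompactSupport.fderiv_apply (𝕜 := ℝ) eZ)) _
          exact this.congr (Eventually.of_forall fun x => (fderiv_heatFlow_apply hψ1 hψ.hasCompactSupport _ x eZ).symm)
        have i1 : Integrable fun x => ⟪w τ x, fderiv ℝ (heatTest 1 ψ σ) x eZ⟫ :=
          integrable_inner_of_aestronglyMeasurable_of_norm_le (hwm τ) (hwB τ) hDi
        have i2 : Integrable fun x => ⟪c τ • eZ, fderiv ℝ (heatTest 1 ψ σ) x eZ⟫ := hDi.const_inner _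
        have h0 : ∫ x, ⟪c τ • eZ, fderiv ℝ (heatTest 1 ψ σ) x eZ⟫ = 0 :=
          integral_inner_const_fderiv_heatFlow_eq_zero hψ1 hψ.hasCompactSupport (1 * σ) (c τ • eZ) eZ
        calc ∫ x, ⟪u τ x, fderiv ℝ (heatTest 1 ψ σ) x eZ⟫
            = ∫ x, (⟪w τ x, fderiv ℝ (heatTest 1 ψ σ) x eZ⟫ + ⟪c τ • eZ, fderiv ℝ (heatTest 1 ψ σ) x eZ⟫) :=
              integral_congr_ae (by filter_upwards [huw τ hτ] with x hx; rw [hx, inner_add_left])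
          _ = ∫ x, ⟪w τ x, fderiv ℝ (heatTest 1 ψ σ) x eZ⟫ := by rw [integral_add i1 i2, h0, add_zero]
      have hzero_u : ∀ n k, ∫ x, ⟪u τ x, fderiv ℝ (heatTest 1 (φs k) ((q n : ℝ) - τ)) x eZ⟫ = 0 :=
        fun n k => by rw [htrans _ (hφs k).1, hm0]
      have hall : ∀ n, ∫ x, ⟪u τ x, fderiv ℝ (heatTest 1 φ ((q n : ℝ) - τ)) x eZ⟫ = 0 := fun n =>
        integral_inner_fderiv_heatTest_eq_zero_of_dense (hmeas τ hτ) (hM τ hτ) hφs hdense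
          (by simpa using hσpos n) (hzero_u n) hφ hdivφ
      exact integral_inner_fderiv_eq_zero_of_tendsto (hmeas τ hτ) (hM τ hτ) hν hσpos hσ hφ hall
    · -- the a.e.-constant rational slices accumulate at `τ⁺`: `u τ` is itself a.e. constant
      push Not at hacc
      obtain ⟨ε, hε, hfar⟩ := hacc
      have hδ : 0 < min ε (-τ) := lt_min hε (by linarith)
      -- rationals `r n ∈ (τ, τ + min ε (-τ) / (n + 2))`
      have hr : ∀ n : ℕ, ∃ r : ℚ, τ < r ∧ (r : ℝ) < τ + min ε (-τ) / ((n : ℝ) + 2) := fun n =>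
        exists_rat_btwn (lt_add_of_pos_right τ (by positivity))
      choose r hτr hrδ using hr
      have hr0 : ∀ n, (r n : ℝ) < 0 := by
        intro n
        have h1 : min ε (-τ) / ((n : ℝ) + 2) ≤ min ε (-τ) / 2 :=
          div_le_div_of_nonneg_left hδ.le (by norm_num) (by linarith [(Nat.cast_nonneg n : (0 : ℝ) ≤ n)])
        have h2 : min ε (-τ) ≤ -τ := min_le_right _ _
        linarith [hrδ n]
      have hrε : ∀ n, (r n : ℝ) < τ + ε := by
        intro n
        have h1 : min ε (-τ) / ((n : ℝ) + 2) ≤ min ε (-τ) / 1 :=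
          div_le_div_of_nonneg_left hδ.le one_pos (by linarith [(Nat.cast_nonneg n : (0 : ℝ) ≤ n)])
        have h2 : min ε (-τ) ≤ ε := min_le_left _ _
        linarith [hrδ n]
      -- these slices are a.e. constant (the `r n` are not honest)
      have hrconst : ∀ n, ∃ κ : EuclideanSpace ℝ (Fin 3), u (r n) =ᵐ[volume] fun _ => κ := by
        intro n
        by_contra hne
        push Not at hne
        have hmem : r n ∈ H := ⟨hr0 n, fun κ => hne κ⟩
        linarith [hfar (r n) hmem (hτr n), hrε n]
      have hrt : Tendsto (fun n => (r n : ℝ)) atTop (𝓝[Iio 0] τ) := by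
        refine tendsto_nhdsWithin_iff.2 ⟨?_, Eventually.of_forall hr0⟩
        have hup : Tendsto (fun n : ℕ => τ + min ε (-τ) / ((n : ℝ) + 2)) atTop (𝓝 τ) := by
          have h1 : Tendsto (fun n : ℕ => min ε (-τ) / ((n : ℝ) + 2)) atTop (𝓝 0) := by
            have := (tendsto_one_div_add_atTop_nhds_zero_nat.comp (tendsto_add_atTop_nat 1)).const_mul (min ε (-τ))
            rw [mul_zero] at this
            refine this.congr fun n => ?_
            simp only [Function.comp_apply, Nat.cast_add, Nat.cast_one]
            ring
          simpa using h1.const_add τ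
        exact tendsto_of_tendsto_of_tendsto_of_le_of_le tendsto_const_nhds hup (fun n => (hτr n).le) fun n => (hrδ n).le
      have hpair0 : ∀ θ : EuclideanSpace ℝ (Fin 3) → EuclideanSpace ℝ (Fin 3),
          FunctionSpaces.IsTestFunctionOn (⊤ : Opens (EuclideanSpace ℝ (Fin 3))) θ → VectorCalculus.IsDivFree θ →
          ∫ x, ⟪u τ x, θ x⟫ = 0 := by
        intro θ hθ hdivθ
        have hθ1 : ContDiff ℝ 1 θ := hθ.contDiff.of_le (by exact_mod_cast le_top)
        have hcont := hu.continuousOn_integral_inner hν hmeas hθ hdivθ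
        have hlim : Tendsto (fun n => ∫ x, ⟪u (r n) x, θ x⟫) atTop (𝓝 (∫ x, ⟪u τ x, θ x⟫)) :=
          (hcont τ hτ).tendsto.comp hrt
        have hvals : ∀ n, ∫ x, ⟪u (r n) x, θ x⟫ = 0 := by
          intro n
          obtain ⟨κ, hκ⟩ := hrconst n
          rw [integral_congr_ae (show (fun x => ⟪u (r n) x, θ x⟫) =ᵐ[volume] fun x => ⟪κ, θ x⟫ by
            filter_upwards [hκ] with x hx; rw [hx])]
          exact integral_inner_const_eq_zero_of_isDivFree κ hθ1 hθ.hasCompactSupport hdivθ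
        exact tendsto_nhds_unique hlim (tendsto_const_nhds.congr fun n => (hvals n).symm)
      obtain ⟨κ, hκ⟩ := IsWeaklyDivFree.exists_ae_eq_const_of_norm_le_of_forall_integral_inner_eq_zero
        (hmeas τ hτ) (hM τ hτ) (hu.1.1 τ hτ) hpair0
      have hDi : Integrable fun x => fderiv ℝ φ x eZ :=
        ((hφ1.continuous_fderiv one_ne_zero).clm_apply continuous_const).integrable_of_hasCompactSupport
          (hφ.hasCompactSupport.fderiv_apply (𝕜 := ℝ) eZ)
      calc ∫ x, ⟪u τ x, fderiv ℝ φ x eZ⟫ = ∫ x, ⟪κ, fderiv ℝ φ x eZ⟫ :=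
            integral_congr_ae (by filter_upwards [hκ] with x hx; rw [hx])
        _ = ⟪κ, ∫ x, fderiv ℝ φ x eZ⟫ := integral_inner hDi κ
        _ = 0 := by rw [integral_fderiv_apply_eq_zero hφ1 hφ.hasCompactSupport eZ, inner_zero_right]
  -- (ix) the drift lemma: `ũ = w + ct e_z = u' + (ct - c) e_z` is a bounded ancient mild solution
  set d : ℝ → ℝ := fun τ => ct τ - c τ with hd_def
  have hd : ∃ D : ℝ, ∀ t < 0, |d t| ≤ D := ⟨M + M, fun t ht =>
    (abs_sub _ _).trans (add_le_add (hctb t) (hcb t ht))⟩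
  have hinv : ∀ᵐ τ ∂((volume : Measure ℝ).restrict (Iio 0)),
      d τ = 0 ∨ ∀ h : ℝ, (fun x => u' τ (x + h • eZ)) =ᵐ[volume] u' τ := by
    filter_upwards [ae_restrict_of_ae (s := Iio (0 : ℝ)) hct_on, ae_restrict_mem measurableSet_Iio] with τ hτG hτ0
    by_cases hmem : τ ∈ Gd
    · left
      show ct τ - c τ = 0
      rw [hτG hmem, sub_self]
    · right
      intro h
      have e1 : (fun x => u' τ (x + h • eZ)) =ᵐ[volume] fun x => u τ (x + h • eZ) :=
        (measurePreserving_add_right volume (h • eZ)).quasiMeasurePreserving.ae_eq (hu'u τ hτ0)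
      exact e1.trans ((hinv_off τ hτ0 hmem h).trans (hu'u τ hτ0).symm)
  have hsol := hu'sol.add_timeConst_smul_of_ae_invariant hu'meas eZ hd hinv
  have hũ_eq : (fun t x => u' t x + d t • eZ) = fun t x => w t x + ct t • eZ := by
    funext t x
    simp only [hu'_def, hd_def, sub_smul]
    abel
  rw [hũ_eq] at hsol
  -- (x) `ũ` is a bounded weak solution, axisymmetric a.e., with swirl in `L^∞_t L^p_x`
  have hũjoint : AEStronglyMeasurable (uncurry fun t x => w t x + ct t • eZ)
      ((volume : Measure (ℝ × EuclideanSpace ℝ (Fin 3))).restrict (Iio 0 ×ˢ univ)) :=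
    (hw.add ((hctm.comp measurable_fst).stronglyMeasurable.smul_const eZ)).aestronglyMeasurable
  have hũsl : ∀ t < 0, AEStronglyMeasurable (fun x => w t x + ct t • eZ) volume := fun t _ =>
    (hwm t).add aestronglyMeasurable_const
  have hweak := hsol.isBoundedWeakNSSolutionOn hν hũjoint hũsl
  have hũU : ∀ t < 0, (fun x => w t x + ct t • eZ) =ᵐ[volume] fun x => u t x + (ct t - c t) • eZ := fun t ht => by
    filter_upwards [hwu' t ht] with x hx
    rw [hx, sub_smul]
    abel
  have haxiU : ∀ t < 0, IsAxisymmetric fun x => u t x + (ct t - c t) • eZ := fun t ht =>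
    isAxisymmetric_add_smul_eZ (haxi t ht) _
  have hax : ∀ θ : ℝ, ∀ᵐ t ∂((volume : Measure ℝ).restrict (Iio 0)),
      (fun x => (fun x => w t x + ct t • eZ) (rotZ θ x)) =ᵐ[volume] fun x => rotZ θ ((fun x => w t x + ct t • eZ) x) := by
    intro θ
    filter_upwards [ae_restrict_mem measurableSet_Iio] with t ht
    have e1 : (fun x => (fun x => w t x + ct t • eZ) (rotZ θ x)) =ᵐ[volume]
        fun x => u t (rotZ θ x) + (ct t - c t) • eZ :=
      (measurePreserving_rotZ θ).quasiMeasurePreserving.ae_eq (hũU t ht)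
    have e2 : (fun x => rotZ θ ((fun x => w t x + ct t • eZ) x)) =ᵐ[volume]
        fun x => rotZ θ (u t x + (ct t - c t) • eZ) := by
      filter_upwards [hũU t ht] with x hx
      simp only [hx]
    have e3 : (fun x => u t (rotZ θ x) + (ct t - c t) • eZ) =ᵐ[volume]
        fun x => rotZ θ (u t x + (ct t - c t) • eZ) :=
      Eventually.of_forall fun x => haxiU t ht θ x
    exact e1.trans (e3.trans e2.symm)
  have hLpU : ∀ᵐ t ∂((volume : Measure ℝ).restrict (Iio 0)),
      eLpNorm (swirl (fun x => w t x + ct t • eZ)) pexp volume ≤ K := by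
    filter_upwards [ae_restrict_mem measurableSet_Iio] with t ht
    have hae : swirl (fun x => w t x + ct t • eZ) =ᵐ[volume] swirl (u t) := by
      filter_upwards [hũU t ht] with x hx
      have : swirl (fun x => w t x + ct t • eZ) x = swirl (fun y => u t y + (ct t - c t) • eZ) x := by
        simp only [swirl, hx]
      rw [this, swirl_add_smul_eZ]
    rw [eLpNorm_congr_ae hae]
    exact hK t ht
  have hsw : ∀ᵐ t ∂((volume : Measure ℝ).restrict (Iio 0)),
      swirl (fun x => w t x + ct t • eZ) =ᵐ[volume] (0 : EuclideanSpace ℝ (Fin 3) → ℝ) :=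
    leiZhangZhao2017_Lp_ae_swirl_free KNSS2009_regularity_axisymmetric_swirl_holds
      (KNSS2009_lemma21_holds (EuclideanSpace ℝ (Fin 3))) hweak hax hp0 hptop.ne hLpU
  obtain ⟨b, -, -, hb⟩ := KNSS2009_liouville_axisymmetric_no_swirl_holds hweak hax hsw
  -- the slices of `u` are a.e. constant for a.e. `t`, hence for every `t`
  have hconst : ∀ᵐ t ∂((volume : Measure ℝ).restrict (Iio 0)),
      u t =ᵐ[volume] fun _ => (b t - (ct t - c t)) • eZ := by
    filter_upwards [hb, ae_restrict_mem measurableSet_Iio] with t hbt ht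
    filter_upwards [hbt, hũU t ht] with x hx hx'
    have hx2 : w t x + ct t • eZ = b t • eZ := hx
    have e : u t x = (w t x + ct t • eZ) - (ct t - c t) • eZ := by rw [hx']; abel
    rw [e, hx2]
    simp only [sub_smul]
  intro t ht
  obtain ⟨κ, hκ⟩ := hu.exists_ae_eq_const_slice hν hmeas hconst t ht
  have hax' := eq_smul_eZ_of_ae_eq_const_of_isAxisymmetric (haxi t ht) hκ
  refine ⟨κ 2, ?_⟩
  rw [hax'] at hκ
  exact hκ

end SelfSimilar

export SelfSimilar (leiZhangZhao2017_Lp_ae_swirl_free)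

end Literature.Analysis.FluidPDE

end
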